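import Summits.QuantumFields.YangMills.Theorems.UnitScaleTiltProp8FlatProp4Background1
import Summits.QuantumFields.YangMills.Theorems.UnitScaleTiltProp8FlatPortDistance
import HarnessLib

/-!
# Route `UnitScaleTilt`, crux K1 child «MinimiserStabilityRegPr» (stmt-QuantumFields-19200), registered stub V2′ `stub_halvingStep` (v8 5b4e846794b80374 ∕ v10
# `BirthV10`) — pillar P3b, **THE LOCAL TWO-PARAMETER FORM OF [Balaban1985Variational] PROPOSITION 4 (98) AT BACKGROUND 1 FOR THE PURE ACTION**:
# `‖W₀(A)(b)‖ ≤ 4d·(20·s·g + η·g² + 1408·s³)` whenever `‖A(b′)‖ ≤ s` and `η⁻¹‖A(b′ + e_ν) − A(b′)‖ ≤ g` ONLY at the bonds `b′` issuing from sites within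
# sup-distance `2` of `b₋`, under the sole smallness `η·s ≤ ½` (the exponents `Y = iηA` small — NOT the field `A`) — the form print's multi-level norms
# (115)/(152) need (`|A| ≤ ε(L^jη)⁻¹` is LARGE at low levels, only `η|A| ≤ εL^{−j}` is small), and from which the LEVEL-WEIGHTED (98)
# `(L^{j(b)}η)³‖W₀(A)(b)‖ ≤ C₄·ε²` of the cube-sequence socket `FlatSmallSolution158CubeSeq.existsUnique_smallSolution158_dom` follows (§4, for any weights
# comparable within distance `2`)

Cell `ym3-torus` (HUMAN RULING D-0037, YM ladder rung R3 — continuum SU(2) YM₃ on the torus is a RUNG, not the Clay problem), width seat `ym-ust-19200-w5` gen 2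
(P3b lineage; LOCATED in this seat's PROGRESS 2∕3: the global-smallness form p596336 `exists_gradient_prop4_bg1` asks `r(L^jη)⁻² < ½`, false at low levels).
`--supports stmt-QuantumFields-19200 --as helper`; def-free, 0 sorry, standard axioms.  The estimates are this seat's gen-0 pair lemmas
`FlatPlaqPairs.norm_deriv_pair13_le ∕ norm_deriv_pair42_le` (generic in `m, Δ, δ, ρ`) read at `m = ηs`, `Δ = δ = η²g`, `ρ = s` instead of `m = ηr`, `Δ = δ = η²r`, `ρ = r`.

THE PRINT (T. Bałaban, CMP **102** (1985) 277–309; journal page = PDF page + 276).  p. 293 (98): *«|(δ/δA′)V(A′)|₍₋₃₎ ≤ C₄(max{|A′|₍₋₁₎, |∇A′|₍₋₂₎})², and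
it is valid if max{|A′|₍₋₁₎, |∇^ηA′|₍₋₂₎} ≤ a₃»* with p. 286 *«sup_j L^jη sup_{Ω_j}|A′| = |A′|₍₋₁₎»*, (115) p. 294 *«|A₁| < ε₄(L^jη)⁻¹, |∇A₁| < ε₄(L^jη)⁻² on
Ω_j»*, (152) p. 301; pp. 291–292 (90)–(96) (the `V₀` term: the derivative is local in the plaquettes `st(b)` through `b`; the Leibniz cancellation (93)–(96)).

WHAT THIS FILE PROVES (every `Params` `P`, level `j`, `0 < η ≤ 1`; `c = iη`):
* §1 `pair_arith_local` — the arithmetic `h(16mΔ + 4mδ + δ²) + 2·44(m + ρh)⁴/ρ ≤ η⁴(20sg + ηg² + 1408s³)` at `m = ηs`, `Δ = δ = η²g`, `ρ = s`, `h ≤ η ≤ 1`, `ηs ≤ ½`.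
* §2 **`norm_pair13_le_local`**, **`norm_pair42_le_local`** — the two plaquettes of a plane through `b` contribute `≤ η⁴(20sg + ηg² + 1408s³)` to `∂_b𝒱_η[E]`
  (`‖E‖ ≤ 1`) under the LOCAL sizes `s` (sup) and `g` (`η⁻¹`-gradient) on the bonds from sites within distance `2` of `b₋`, and `ηs ≤ ½`.
* §3 **`norm_fderiv_single_le_local`** (`|D𝒱_η(A)[1_bE]| ≤ 2d·η⁴(20sg + ηg² + 1408s³)`) and **`norm_gradient_le_local`** — for ANY `W` representing `D𝒱_η` in
  print's pairing (`D𝒱_η(A)[δ] = η⁴Σ_b tr(W(A)(b)δ(b))`, the (grad) clause of `exists_gradient_prop4_bg1`, which pins `W`): `‖W(A)(b)‖ ≤ 4d(20sg + ηg² + 1408s³)`.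
* (sequel `UnitScaleTiltProp8FlatProp4Bg1Weighted`) **`weighted98_of_local`** — THE LEVEL-WEIGHTED (98): for weights `w₁` with `η ≤ w₁(b) ≤ 1` and `w₁(b) ≤ Λ·w₁(b′)` whenever `dist(b′₋, b₋) ≤ 2` (`Λ ≥ 1`; the
  P2 level weights `w₁ = L^{j(b₋)}η` have `Λ = L²`), the sizes `w₁(b)‖A(b)‖ ≤ r`, `w₁(b)²·η⁻¹‖A(b + e_ν) − A(b)‖ ≤ r` everywhere with `r ≤ 1/(2Λ)` give
  `w₁(b)³‖W(A)(b)‖ ≤ 4d·Λ³(1428 + Λ)·r²` at every bond — the `hWq` shape of `existsUnique_smallSolution158_dom` with `w m = w₁^m`, `a₃ = 1/(2Λ)`, `C₄ = 4dΛ³(1428 + Λ)`.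
HONEST SCOPE: (i) pure action `V₀` only (the dressing is `FlatProp4Dressing`); (ii) that the cube sequence's level weights satisfy §4's comparability (neighbouring
blocks' levels differ by ≤ 1, [Balaban1984PropagatorsII] (2.1)–(2.2)) is NOT proved here; (iii) constants crude; (iv) NOT a claim about the stub, the crux, the rung or the gap.

References: T. Bałaban, CMP **102** (1985) 277–309 [Balaban1985Variational] p.286, (90)–(98) pp.291–293, (115) p.294, (152) p.301, Sect. F p.302.
-/

set_option autoImplicit false

noncomputable section

open scoped BigOperators Matrix.Norms.L2Operator
open NormedSpace Finset

namespace Summit.QuantumFields.YangMills.Theorems.FlatProp4Bg1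

open Literature.MathematicalPhysics.QuantumFieldTheory.Balaban1983to89
open Summit.QuantumFields.YangMills.Theorems.FlatPlaqCubic
open Summit.QuantumFields.YangMills.Theorems.FlatPlaqDeriv
open Summit.QuantumFields.YangMills.Theorems.FlatPlaqIncidence
open Summit.QuantumFields.YangMills.BalabanUVNodes.N09OneDefectAveraging (shift_ne_self)
open B5Eq117TorusCarriers (Mk)
open B5Prop12FieldsLattice (distSite)
open B5RowSumsP12Lattice (distSite_comm distSite_triangle)
open FlatPortDistance (distSite_shift_le_one)

variable {P : Params} {j : ℕ}

/-! ## §1 The arithmetic of one pair at `m = ηs`, `Δ = δ = η²g`, `ρ = s` -/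

section Pairs

variable {η : ℝ}

/-- With `m = ηs`, `Δ = δ = η²g`, `ρ = s`, `‖H‖ = h ≤ η ≤ 1`, `0 < s`, `0 ≤ g`, `ηs ≤ ½`: the pair bound is `≤ η⁴(20sg + ηg² + 1408s³)`. [folklore] -/
theorem pair_arith_local {s g h : ℝ} (hη : 0 < η) (hs : 0 < s) (hg : 0 ≤ g) (h0 : 0 ≤ h) (hh : h ≤ η) :
    h * (16 * (η * s) * (η * (η * g)) + 4 * (η * s) * (η * (η * g)) + (η * (η * g)) ^ 2) + 2 * (44 * (η * s + s * h) ^ 4 / s)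
      ≤ η ^ 4 * (20 * s * g + η * g ^ 2 + 1408 * s ^ 3) := by
  have e : (η * s + s * h) ^ 4 / s = s ^ 3 * (η + h) ^ 4 := by
    rw [div_eq_iff hs.ne']
    ring
  rw [mul_div_assoc, e]
  have hη3 : 0 ≤ η ^ 3 := by positivity
  have hη4 : 0 ≤ η ^ 4 := by positivity
  have hsg : 0 ≤ s * g := mul_nonneg hs.le hg
  have h1 : h * (16 * (η * s) * (η * (η * g)) + 4 * (η * s) * (η * (η * g)) + (η * (η * g)) ^ 2) ≤ η ^ 4 * (20 * s * g + η * g ^ 2) := by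
    have : h * (16 * (η * s) * (η * (η * g)) + 4 * (η * s) * (η * (η * g)) + (η * (η * g)) ^ 2) = 20 * (η ^ 3 * h) * (s * g) + (η ^ 4 * h) * g ^ 2 := by ring
    rw [this]
    have a1 : η ^ 3 * h ≤ η ^ 3 * η := mul_le_mul_of_nonneg_left hh hη3
    have a2 : η ^ 4 * h ≤ η ^ 4 * η := mul_le_mul_of_nonneg_left hh hη4
    nlinarith [mul_le_mul_of_nonneg_right a1 hsg, mul_le_mul_of_nonneg_right a2 (sq_nonneg g)]
  have h2 : (η + h) ^ 4 ≤ (2 * η) ^ 4 := pow_le_pow_left₀ (by linarith) (by linarith) 4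
  have h3 : 2 * (44 * (s ^ 3 * (η + h) ^ 4)) ≤ η ^ 4 * (1408 * s ^ 3) := by
    have hs3 : 0 ≤ s ^ 3 := by positivity
    nlinarith [mul_le_mul_of_nonneg_left h2 hs3]
  nlinarith

variable [DecidableEq (PBond P j)]

/-- **THE (1,3)-PAIR AT THE LATTICE, LOCAL SIZES**: for `b = ⟨x₀, μ⟩` and `μ < ν`, the plaquettes `p_{μν}(x₀)` (slot 1) and `p_{μν}(x₀ − e_ν)` (slot 3) contribute
together at most `η⁴(20sg + ηg² + 1408s³)` to `∂_b𝒱_η[E]` (`‖E‖ ≤ 1`) when `‖A(b′)‖ ≤ s` and `η⁻¹‖A(b′ + e_κ) − A(b′)‖ ≤ g` for the bonds `b′` from sites within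
sup-distance `2` of `x₀`, `0 < s`, `ηs ≤ ½`. [cite: Balaban1985Variational, (90)-(96) pp.291-292, (98) p.293] -/
theorem norm_pair13_le_local (hη : 0 < η) {s g : ℝ} (hs : 0 < s) (hg : 0 ≤ g) (hηs : η * s ≤ 1 / 2)
    (A : PBond P j → Matrix (Fin 2) (Fin 2) ℂ) (x₀ : Site P j)
    (hA : ∀ b' : PBond P j, distSite (Mk P j) b'.src x₀ ≤ 2 → ‖A b'‖ ≤ s)
    (hD : ∀ (s' : Site P j) (μ ν : Fin P.d), distSite (Mk P j) s' x₀ ≤ 2 → η⁻¹ * ‖A ⟨s'.shift ν, μ⟩ - A ⟨s', μ⟩‖ ≤ g)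
    (E : Matrix (Fin 2) (Fin 2) ℂ) (hE : ‖E‖ ≤ 1) (b : PBond P j) (hb : b.src = x₀) (ν : Fin P.d) (h : b.dir < ν) :
    ‖deriv (fun t : ℂ => (1 - (2 : ℂ)⁻¹ * Matrix.trace (exp (((Complex.I * (η : ℂ)) • A ⟨(⟨b.src, b.dir, ν, h⟩ : Plaq P j).src, (⟨b.src, b.dir, ν, h⟩ : Plaq P j).μ⟩) + t • ((Complex.I * (η : ℂ)) • (Pi.single b E : PBond P j → Matrix (Fin 2) (Fin 2) ℂ) ⟨(⟨b.src, b.dir, ν, h⟩ : Plaq P j).src, (⟨b.src, b.dir, ν, h⟩ : Plaq P j).μ⟩)) * exp (((Complex.I * (η : ℂ)) • A ⟨(⟨b.src, b.dir, ν, h⟩ : Plaq P j).src.shift (⟨b.src, b.dir, ν, h⟩ : Plaq P j).μ, (⟨b.src, b.dir, ν, h⟩ : Plaq P j).ν⟩) + t • ((Complex.I * (η : ℂ)) • (Pi.single b E : PBond P j → Matrix (Fin 2) (Fin 2) ℂ) ⟨(⟨b.src, b.dir, ν, h⟩ : Plaq P j).src.shift (⟨b.src, b.dir, ν, h⟩ :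 Plaq P j).μ, (⟨b.src, b.dir, ν, h⟩ : Plaq P j).ν⟩)) * exp ((-((Complex.I * (η : ℂ)) • A ⟨(⟨b.src, b.dir, ν, h⟩ : Plaq P j).src.shift (⟨b.src, b.dir, ν, h⟩ : Plaq P j).ν, (⟨b.src, b.dir, ν, h⟩ : Plaq P j).μ⟩)) + t • (-((Complex.I * (η : ℂ)) • (Pi.single b E : PBond P j → Matrix (Fin 2) (Fin 2) ℂ) ⟨(⟨b.src, b.dir, ν, h⟩ : Plaq P j).src.shift (⟨b.src, b.dir, ν, h⟩ : Plaq P j).ν, (⟨b.src, b.dir, ν, h⟩ : Plaq P j).μ⟩))) * exp ((-((Complex.I * (η : ℂ)) • A ⟨(⟨b.src, b.dir, ν, h⟩ : Plaq P j).src, (⟨b.src, b.dir, ν, h⟩ : Plaq P j).ν⟩)) + t • (-((Complex.I * (η : ℂ)) • (Pi.single b E : PBond P j → Matrix (Fin 2) (Fin 2) ℂ) ⟨(⟨b.src, b.dir, ν, h⟩ : Plaq P j).src, (⟨b.src, b.dir, ν, h⟩ : Plaq P j).ν⟩)))) + (2 : ℂ)⁻¹ * Matrix.trace ((((Complex.I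 * (η : ℂ)) • A ⟨(⟨b.src, b.dir, ν, h⟩ : Plaq P j).src, (⟨b.src, b.dir, ν, h⟩ : Plaq P j).μ⟩) + t • ((Complex.I * (η : ℂ)) • (Pi.single b E : PBond P j → Matrix (Fin 2) (Fin 2) ℂ) ⟨(⟨b.src, b.dir, ν, h⟩ : Plaq P j).src, (⟨b.src, b.dir, ν, h⟩ : Plaq P j).μ⟩)) + (((Complex.I * (η : ℂ)) • A ⟨(⟨b.src, b.dir, ν, h⟩ : Plaq P j).src.shift (⟨b.src, b.dir, ν, h⟩ : Plaq P j).μ, (⟨b.src, b.dir, ν, h⟩ : Plaq P j).ν⟩) + t • ((Complex.I * (η : ℂ)) • (Pi.single b E : PBond P j → Matrix (Fin 2) (Fin 2) ℂ) ⟨(⟨b.src, b.dir, ν, h⟩ : Plaq P j).src.shift (⟨b.src, b.dir, ν, h⟩ : Plaq P j).μ, (⟨b.src, b.dir, ν, h⟩ : Plaq P j).ν⟩)) + ((-((Complex.I * (η : ℂ)) • A ⟨(⟨b.src, b.dir, ν, h⟩ : Plaq P j).src.shift (⟨b.src, b.dir, ν, h⟩ : Plaq P j).ν, (⟨b.src,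 b.dir, ν, h⟩ : Plaq P j).μ⟩)) + t • (-((Complex.I * (η : ℂ)) • (Pi.single b E : PBond P j → Matrix (Fin 2) (Fin 2) ℂ) ⟨(⟨b.src, b.dir, ν, h⟩ : Plaq P j).src.shift (⟨b.src, b.dir, ν, h⟩ : Plaq P j).ν, (⟨b.src, b.dir, ν, h⟩ : Plaq P j).μ⟩))) + ((-((Complex.I * (η : ℂ)) • A ⟨(⟨b.src, b.dir, ν, h⟩ : Plaq P j).src, (⟨b.src, b.dir, ν, h⟩ : Plaq P j).ν⟩)) + t • (-((Complex.I * (η : ℂ)) • (Pi.single b E : PBond P j → Matrix (Fin 2) (Fin 2) ℂ) ⟨(⟨b.src, b.dir, ν, h⟩ : Plaq P j).src, (⟨b.src, b.dir, ν, h⟩ : Plaq P j).ν⟩)))) + (4 : ℂ)⁻¹ * Matrix.trace (((((Complex.I * (η : ℂ)) • A ⟨(⟨b.src, b.dir, ν, h⟩ : Plaq P j).src, (⟨b.src, b.dir, ν, h⟩ : Plaq P j).μ⟩) + t • ((Complex.I * (η : ℂ)) • (Pi.single b E : PBond P j → Matrix (Fin 2) (Fin 2) ℂ) ⟨(⟨b.src,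 b.dir, ν, h⟩ : Plaq P j).src, (⟨b.src, b.dir, ν, h⟩ : Plaq P j).μ⟩)) + (((Complex.I * (η : ℂ)) • A ⟨(⟨b.src, b.dir, ν, h⟩ : Plaq P j).src.shift (⟨b.src, b.dir, ν, h⟩ : Plaq P j).μ, (⟨b.src, b.dir, ν, h⟩ : Plaq P j).ν⟩) + t • ((Complex.I * (η : ℂ)) • (Pi.single b E : PBond P j → Matrix (Fin 2) (Fin 2) ℂ) ⟨(⟨b.src, b.dir, ν, h⟩ : Plaq P j).src.shift (⟨b.src, b.dir, ν, h⟩ : Plaq P j).μ, (⟨b.src, b.dir, ν, h⟩ : Plaq P j).ν⟩)) + ((-((Complex.I * (η : ℂ)) • A ⟨(⟨b.src, b.dir, ν, h⟩ : Plaq P j).src.shift (⟨b.src, b.dir, ν, h⟩ : Plaq P j).ν, (⟨b.src, b.dir, ν, h⟩ : Plaq P j).μ⟩)) + t • (-((Complex.I * (η : ℂ)) • (Pi.single b E : PBond P j → Matrix (Fin 2) (Fin 2) ℂ) ⟨(⟨b.src, b.dir, ν, h⟩ : Plaq P j).src.shift (⟨b.src, b.dir, ν, h⟩ : Plaq P j).ν,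 (⟨b.src, b.dir, ν, h⟩ : Plaq P j).μ⟩))) + ((-((Complex.I * (η : ℂ)) • A ⟨(⟨b.src, b.dir, ν, h⟩ : Plaq P j).src, (⟨b.src, b.dir, ν, h⟩ : Plaq P j).ν⟩)) + t • (-((Complex.I * (η : ℂ)) • (Pi.single b E : PBond P j → Matrix (Fin 2) (Fin 2) ℂ) ⟨(⟨b.src, b.dir, ν, h⟩ : Plaq P j).src, (⟨b.src, b.dir, ν, h⟩ : Plaq P j).ν⟩)))) ^ 2))) 0 + deriv (fun t : ℂ => (1 - (2 : ℂ)⁻¹ * Matrix.trace (exp (((Complex.I * (η : ℂ)) • A ⟨(⟨b.src.unshift ν, b.dir, ν, h⟩ : Plaq P j).src, (⟨b.src.unshift ν, b.dir, ν, h⟩ : Plaq P j).μ⟩) + t • ((Complex.I * (η : ℂ)) • (Pi.single b E : PBond P j → Matrix (Fin 2) (Fin 2) ℂ) ⟨(⟨b.src.unshift ν, b.dir, ν, h⟩ : Plaq P j).src, (⟨b.src.unshift ν, b.dir, ν, h⟩ : Plaq P j).μ⟩)) * exp (((Complex.I * (η : ℂ)) • A ⟨(⟨b.src.unshift ν, b.dir,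 ν, h⟩ : Plaq P j).src.shift (⟨b.src.unshift ν, b.dir, ν, h⟩ : Plaq P j).μ, (⟨b.src.unshift ν, b.dir, ν, h⟩ : Plaq P j).ν⟩) + t • ((Complex.I * (η : ℂ)) • (Pi.single b E : PBond P j → Matrix (Fin 2) (Fin 2) ℂ) ⟨(⟨b.src.unshift ν, b.dir, ν, h⟩ : Plaq P j).src.shift (⟨b.src.unshift ν, b.dir, ν, h⟩ : Plaq P j).μ, (⟨b.src.unshift ν, b.dir, ν, h⟩ : Plaq P j).ν⟩)) * exp ((-((Complex.I * (η : ℂ)) • A ⟨(⟨b.src.unshift ν, b.dir, ν, h⟩ : Plaq P j).src.shift (⟨b.src.unshift ν, b.dir, ν, h⟩ : Plaq P j).ν, (⟨b.src.unshift ν, b.dir, ν, h⟩ : Plaq P j).μ⟩)) + t • (-((Complex.I * (η : ℂ)) • (Pi.single b E : PBond P j → Matrix (Fin 2) (Fin 2) ℂ) ⟨(⟨b.src.unshift ν, b.dir, ν, h⟩ : Plaq P j).src.shift (⟨b.src.unshift ν, b.dir, ν, h⟩ : Plaq P j).ν, (⟨b.src.unshift ν, b.dir, ν, h⟩ : Plaq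 P j).μ⟩))) * exp ((-((Complex.I * (η : ℂ)) • A ⟨(⟨b.src.unshift ν, b.dir, ν, h⟩ : Plaq P j).src, (⟨b.src.unshift ν, b.dir, ν, h⟩ : Plaq P j).ν⟩)) + t • (-((Complex.I * (η : ℂ)) • (Pi.single b E : PBond P j → Matrix (Fin 2) (Fin 2) ℂ) ⟨(⟨b.src.unshift ν, b.dir, ν, h⟩ : Plaq P j).src, (⟨b.src.unshift ν, b.dir, ν, h⟩ : Plaq P j).ν⟩)))) + (2 : ℂ)⁻¹ * Matrix.trace ((((Complex.I * (η : ℂ)) • A ⟨(⟨b.src.unshift ν, b.dir, ν, h⟩ : Plaq P j).src, (⟨b.src.unshift ν, b.dir, ν, h⟩ : Plaq P j).μ⟩) + t • ((Complex.I * (η : ℂ)) • (Pi.single b E : PBond P j → Matrix (Fin 2) (Fin 2) ℂ) ⟨(⟨b.src.unshift ν, b.dir, ν, h⟩ : Plaq P j).src, (⟨b.src.unshift ν, b.dir, ν, h⟩ : Plaq P j).μ⟩)) + (((Complex.I * (η : ℂ)) • A ⟨(⟨b.src.unshift ν, b.dir, ν, h⟩ : Plaq P j).src.shift (⟨b.src.unshift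 ν, b.dir, ν, h⟩ : Plaq P j).μ, (⟨b.src.unshift ν, b.dir, ν, h⟩ : Plaq P j).ν⟩) + t • ((Complex.I * (η : ℂ)) • (Pi.single b E : PBond P j → Matrix (Fin 2) (Fin 2) ℂ) ⟨(⟨b.src.unshift ν, b.dir, ν, h⟩ : Plaq P j).src.shift (⟨b.src.unshift ν, b.dir, ν, h⟩ : Plaq P j).μ, (⟨b.src.unshift ν, b.dir, ν, h⟩ : Plaq P j).ν⟩)) + ((-((Complex.I * (η : ℂ)) • A ⟨(⟨b.src.unshift ν, b.dir, ν, h⟩ : Plaq P j).src.shift (⟨b.src.unshift ν, b.dir, ν, h⟩ : Plaq P j).ν, (⟨b.src.unshift ν, b.dir, ν, h⟩ : Plaq P j).μ⟩)) + t • (-((Complex.I * (η : ℂ)) • (Pi.single b E : PBond P j → Matrix (Fin 2) (Fin 2) ℂ) ⟨(⟨b.src.unshift ν, b.dir, ν, h⟩ : Plaq P j).src.shift (⟨b.src.unshift ν, b.dir, ν, h⟩ : Plaq P j).ν, (⟨b.src.unshift ν, b.dir, ν, h⟩ : Plaq P j).μ⟩))) + ((-((Complex.I * (η : ℂ)) •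 A ⟨(⟨b.src.unshift ν, b.dir, ν, h⟩ : Plaq P j).src, (⟨b.src.unshift ν, b.dir, ν, h⟩ : Plaq P j).ν⟩)) + t • (-((Complex.I * (η : ℂ)) • (Pi.single b E : PBond P j → Matrix (Fin 2) (Fin 2) ℂ) ⟨(⟨b.src.unshift ν, b.dir, ν, h⟩ : Plaq P j).src, (⟨b.src.unshift ν, b.dir, ν, h⟩ : Plaq P j).ν⟩)))) + (4 : ℂ)⁻¹ * Matrix.trace (((((Complex.I * (η : ℂ)) • A ⟨(⟨b.src.unshift ν, b.dir, ν, h⟩ : Plaq P j).src, (⟨b.src.unshift ν, b.dir, ν, h⟩ : Plaq P j).μ⟩) + t • ((Complex.I * (η : ℂ)) • (Pi.single b E : PBond P j → Matrix (Fin 2) (Fin 2) ℂ) ⟨(⟨b.src.unshift ν, b.dir, ν, h⟩ : Plaq P j).src, (⟨b.src.unshift ν, b.dir, ν, h⟩ : Plaq P j).μ⟩)) + (((Complex.I * (η : ℂ)) • A ⟨(⟨b.src.unshift ν, b.dir, ν, h⟩ : Plaq P j).src.shift (⟨b.src.unshift ν, b.dir, ν, h⟩ : Plaq P j).μ, (⟨b.src.unshift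 ν, b.dir, ν, h⟩ : Plaq P j).ν⟩) + t • ((Complex.I * (η : ℂ)) • (Pi.single b E : PBond P j → Matrix (Fin 2) (Fin 2) ℂ) ⟨(⟨b.src.unshift ν, b.dir, ν, h⟩ : Plaq P j).src.shift (⟨b.src.unshift ν, b.dir, ν, h⟩ : Plaq P j).μ, (⟨b.src.unshift ν, b.dir, ν, h⟩ : Plaq P j).ν⟩)) + ((-((Complex.I * (η : ℂ)) • A ⟨(⟨b.src.unshift ν, b.dir, ν, h⟩ : Plaq P j).src.shift (⟨b.src.unshift ν, b.dir, ν, h⟩ : Plaq P j).ν, (⟨b.src.unshift ν, b.dir, ν, h⟩ : Plaq P j).μ⟩)) + t • (-((Complex.I * (η : ℂ)) • (Pi.single b E : PBond P j → Matrix (Fin 2) (Fin 2) ℂ) ⟨(⟨b.src.unshift ν, b.dir, ν, h⟩ : Plaq P j).src.shift (⟨b.src.unshift ν, b.dir, ν, h⟩ : Plaq P j).ν, (⟨b.src.unshift ν, b.dir, ν, h⟩ : Plaq P j).μ⟩))) + ((-((Complex.I * (η : ℂ)) • A ⟨(⟨b.src.unshift ν, b.dir, ν, h⟩ : Plaq P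 j).src, (⟨b.src.unshift ν, b.dir, ν, h⟩ : Plaq P j).ν⟩)) + t • (-((Complex.I * (η : ℂ)) • (Pi.single b E : PBond P j → Matrix (Fin 2) (Fin 2) ℂ) ⟨(⟨b.src.unshift ν, b.dir, ν, h⟩ : Plaq P j).src, (⟨b.src.unshift ν, b.dir, ν, h⟩ : Plaq P j).ν⟩)))) ^ 2))) 0‖ ≤ η ^ 4 * (20 * s * g + η * g ^ 2 + 1408 * s ^ 3) := by
  obtain ⟨x, μ⟩ := b
  change x = x₀ at hb
  subst hb
  -- the sites involved are within sup-distance 2 of the centre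
  have d0 : distSite (Mk P j) x x ≤ 2 := by rw [B5Prop12FieldsLattice.distSite_self]; norm_num
  have dsh : ∀ κ : Fin P.d, distSite (Mk P j) (x.shift κ) x ≤ 2 := fun κ => (distSite_shift_le_one x κ).trans (by norm_num)
  have dun : ∀ κ : Fin P.d, distSite (Mk P j) (x.unshift κ) x ≤ 1 := fun κ => by
    have h := distSite_shift_le_one (x.unshift κ) κ
    rw [Site.shift_unshift] at h
    rwa [distSite_comm]
  have du : ∀ κ : Fin P.d, distSite (Mk P j) (x.unshift κ) x ≤ 2 := fun κ => (dun κ).trans (by norm_num)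
  have dus : ∀ κ κ' : Fin P.d, distSite (Mk P j) ((x.unshift κ).shift κ') x ≤ 2 := fun κ κ' => by
    have h := distSite_triangle (Mk P j) ((x.unshift κ).shift κ') (x.unshift κ) x
    linarith [distSite_shift_le_one (x.unshift κ) κ', dun κ]
  have hμν : μ ≠ ν := ne_of_lt h
  have hD' : ∀ (s' : Site P j) (μ' ν' : Fin P.d), distSite (Mk P j) s' x ≤ 2 → ‖A ⟨s'.shift ν', μ'⟩ - A ⟨s', μ'⟩‖ ≤ η * g :=
    fun s' μ' ν' hd => (inv_mul_le_iff₀ hη).mp (hD s' μ' ν' hd)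
  -- the two line functions, with the bond in slot 1 (direction `iηE`) and slot 3 (direction `−iηE`)
  have n2 : (⟨x.shift μ, ν⟩ : PBond P j) ≠ ⟨x, μ⟩ := fun e => hμν.symm (by simp only [PBond.mk.injEq] at e; exact e.2)
  have n3 : (⟨x.shift ν, μ⟩ : PBond P j) ≠ ⟨x, μ⟩ := fun e => shift_ne_self x ν (by simp only [PBond.mk.injEq] at e; exact e.1)
  have n4 : (⟨x, ν⟩ : PBond P j) ≠ ⟨x, μ⟩ := fun e => hμν.symm (by simp only [PBond.mk.injEq] at e; exact e.2)
  have m1 : (⟨x.unshift ν, μ⟩ : PBond P j) ≠ ⟨x, μ⟩ := fun e => unshift_ne_self x ν (by simp only [PBond.mk.injEq] at e; exact e.1)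
  have m2 : (⟨(x.unshift ν).shift μ, ν⟩ : PBond P j) ≠ ⟨x, μ⟩ := fun e => hμν.symm (by simp only [PBond.mk.injEq] at e; exact e.2)
  have m4 : (⟨x.unshift ν, ν⟩ : PBond P j) ≠ ⟨x, μ⟩ := fun e => hμν.symm (by simp only [PBond.mk.injEq] at e; exact e.2)
  have F1 : (fun t : ℂ => (1 - (2 : ℂ)⁻¹ * Matrix.trace (exp (((Complex.I * (η : ℂ)) • A ⟨(⟨x, μ, ν, h⟩ : Plaq P j).src, (⟨x, μ, ν, h⟩ : Plaq P j).μ⟩) + t • ((Complex.I * (η : ℂ)) • (Pi.single (⟨x, μ⟩ : PBond P j) E : PBond P j → Matrix (Fin 2) (Fin 2) ℂ) ⟨(⟨x, μ, ν, h⟩ : Plaq P j).src, (⟨x, μ, ν, h⟩ : Plaq P j).μ⟩)) * exp (((Complex.I * (η : ℂ)) • A ⟨(⟨x, μ, ν, h⟩ : Plaq P j).src.shift (⟨x, μ, ν, h⟩ : Plaq P j).μ, (⟨x, μ, ν, h⟩ : Plaq P j).ν⟩) + t • ((Complex.I * (η : ℂ)) • (Pi.single (⟨x, μ⟩ : PBond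 P j) E : PBond P j → Matrix (Fin 2) (Fin 2) ℂ) ⟨(⟨x, μ, ν, h⟩ : Plaq P j).src.shift (⟨x, μ, ν, h⟩ : Plaq P j).μ, (⟨x, μ, ν, h⟩ : Plaq P j).ν⟩)) * exp ((-((Complex.I * (η : ℂ)) • A ⟨(⟨x, μ, ν, h⟩ : Plaq P j).src.shift (⟨x, μ, ν, h⟩ : Plaq P j).ν, (⟨x, μ, ν, h⟩ : Plaq P j).μ⟩)) + t • (-((Complex.I * (η : ℂ)) • (Pi.single (⟨x, μ⟩ : PBond P j) E : PBond P j → Matrix (Fin 2) (Fin 2) ℂ) ⟨(⟨x, μ, ν, h⟩ : Plaq P j).src.shift (⟨x, μ, ν, h⟩ : Plaq P j).ν, (⟨x, μ, ν, h⟩ : Plaq P j).μ⟩))) * exp ((-((Complex.I * (η : ℂ)) • A ⟨(⟨x, μ, ν, h⟩ : Plaq P j).src, (⟨x, μ, ν, h⟩ : Plaq P j).ν⟩)) + t • (-((Complex.I * (η : ℂ)) • (Pi.single (⟨x, μ⟩ : PBond P j) E : PBond P j → Matrix (Fin 2) (Fin 2) ℂ) ⟨(⟨x, μ, ν, h⟩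 : Plaq P j).src, (⟨x, μ, ν, h⟩ : Plaq P j).ν⟩)))) + (2 : ℂ)⁻¹ * Matrix.trace ((((Complex.I * (η : ℂ)) • A ⟨(⟨x, μ, ν, h⟩ : Plaq P j).src, (⟨x, μ, ν, h⟩ : Plaq P j).μ⟩) + t • ((Complex.I * (η : ℂ)) • (Pi.single (⟨x, μ⟩ : PBond P j) E : PBond P j → Matrix (Fin 2) (Fin 2) ℂ) ⟨(⟨x, μ, ν, h⟩ : Plaq P j).src, (⟨x, μ, ν, h⟩ : Plaq P j).μ⟩)) + (((Complex.I * (η : ℂ)) • A ⟨(⟨x, μ, ν, h⟩ : Plaq P j).src.shift (⟨x, μ, ν, h⟩ : Plaq P j).μ, (⟨x, μ, ν, h⟩ : Plaq P j).ν⟩) + t • ((Complex.I * (η : ℂ)) • (Pi.single (⟨x, μ⟩ : PBond P j) E : PBond P j → Matrix (Fin 2) (Fin 2) ℂ) ⟨(⟨x, μ, ν, h⟩ : Plaq P j).src.shift (⟨x, μ, ν, h⟩ : Plaq P j).μ, (⟨x, μ, ν, h⟩ : Plaq P j).ν⟩)) + ((-((Complex.I * (η : ℂ)) • A ⟨(⟨x,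 μ, ν, h⟩ : Plaq P j).src.shift (⟨x, μ, ν, h⟩ : Plaq P j).ν, (⟨x, μ, ν, h⟩ : Plaq P j).μ⟩)) + t • (-((Complex.I * (η : ℂ)) • (Pi.single (⟨x, μ⟩ : PBond P j) E : PBond P j → Matrix (Fin 2) (Fin 2) ℂ) ⟨(⟨x, μ, ν, h⟩ : Plaq P j).src.shift (⟨x, μ, ν, h⟩ : Plaq P j).ν, (⟨x, μ, ν, h⟩ : Plaq P j).μ⟩))) + ((-((Complex.I * (η : ℂ)) • A ⟨(⟨x, μ, ν, h⟩ : Plaq P j).src, (⟨x, μ, ν, h⟩ : Plaq P j).ν⟩)) + t • (-((Complex.I * (η : ℂ)) • (Pi.single (⟨x, μ⟩ : PBond P j) E : PBond P j → Matrix (Fin 2) (Fin 2) ℂ) ⟨(⟨x, μ, ν, h⟩ : Plaq P j).src, (⟨x, μ, ν, h⟩ : Plaq P j).ν⟩)))) + (4 : ℂ)⁻¹ * Matrix.trace (((((Complex.I * (η : ℂ)) • A ⟨(⟨x, μ, ν, h⟩ : Plaq P j).src, (⟨x, μ, ν, h⟩ : Plaq P j).μ⟩) + t • ((Complex.I * (η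 : ℂ)) • (Pi.single (⟨x, μ⟩ : PBond P j) E : PBond P j → Matrix (Fin 2) (Fin 2) ℂ) ⟨(⟨x, μ, ν, h⟩ : Plaq P j).src, (⟨x, μ, ν, h⟩ : Plaq P j).μ⟩)) + (((Complex.I * (η : ℂ)) • A ⟨(⟨x, μ, ν, h⟩ : Plaq P j).src.shift (⟨x, μ, ν, h⟩ : Plaq P j).μ, (⟨x, μ, ν, h⟩ : Plaq P j).ν⟩) + t • ((Complex.I * (η : ℂ)) • (Pi.single (⟨x, μ⟩ : PBond P j) E : PBond P j → Matrix (Fin 2) (Fin 2) ℂ) ⟨(⟨x, μ, ν, h⟩ : Plaq P j).src.shift (⟨x, μ, ν, h⟩ : Plaq P j).μ, (⟨x, μ, ν, h⟩ : Plaq P j).ν⟩)) + ((-((Complex.I * (η : ℂ)) • A ⟨(⟨x, μ, ν, h⟩ : Plaq P j).src.shift (⟨x, μ, ν, h⟩ : Plaq P j).ν, (⟨x, μ, ν, h⟩ : Plaq P j).μ⟩)) + t • (-((Complex.I * (η : ℂ)) • (Pi.single (⟨x, μ⟩ : PBond P j) E : PBond P j → Matrix (Fin 2) (Fin 2) ℂ)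 ⟨(⟨x, μ, ν, h⟩ : Plaq P j).src.shift (⟨x, μ, ν, h⟩ : Plaq P j).ν, (⟨x, μ, ν, h⟩ : Plaq P j).μ⟩))) + ((-((Complex.I * (η : ℂ)) • A ⟨(⟨x, μ, ν, h⟩ : Plaq P j).src, (⟨x, μ, ν, h⟩ : Plaq P j).ν⟩)) + t • (-((Complex.I * (η : ℂ)) • (Pi.single (⟨x, μ⟩ : PBond P j) E : PBond P j → Matrix (Fin 2) (Fin 2) ℂ) ⟨(⟨x, μ, ν, h⟩ : Plaq P j).src, (⟨x, μ, ν, h⟩ : Plaq P j).ν⟩)))) ^ 2))) =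
      fun t : ℂ => (1 - (2 : ℂ)⁻¹ * Matrix.trace (exp (((Complex.I * (η : ℂ)) • A ⟨x, μ⟩) + t • ((Complex.I * (η : ℂ)) • E)) * exp ((Complex.I * (η : ℂ)) • A ⟨x.shift μ, ν⟩) * exp (-((Complex.I * (η : ℂ)) • A ⟨x.shift ν, μ⟩)) * exp (-((Complex.I * (η : ℂ)) • A ⟨x, ν⟩))) + (2 : ℂ)⁻¹ * Matrix.trace ((((Complex.I * (η : ℂ)) • A ⟨x, μ⟩) + t • ((Complex.I * (η : ℂ)) • E)) + ((Complex.I * (η : ℂ)) • A ⟨x.shift μ, ν⟩) + (-((Complex.I * (η : ℂ)) • A ⟨x.shift ν, μ⟩)) + (-((Complex.I * (η : ℂ)) • A ⟨x, ν⟩))) + (4 : ℂ)⁻¹ * Matrix.trace (((((Complex.I * (η : ℂ)) • A ⟨x, μ⟩) + t • ((Complex.I * (η : ℂ)) • E)) + ((Complex.I * (η : ℂ)) • A ⟨x.shift μ, ν⟩) + (-((Complex.I * (η : ℂ)) • A ⟨x.shift ν, μ⟩)) + (-((Complex.I * (η : ℂ)) • A ⟨x, ν⟩))) ^ 2)) :=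 by
    funext t
    simp only [Pi.single_eq_same, Pi.single_apply, if_neg n2, if_neg n3, if_neg n4, smul_zero, neg_zero, add_zero]
  have F3 : (fun t : ℂ => (1 - (2 : ℂ)⁻¹ * Matrix.trace (exp (((Complex.I * (η : ℂ)) • A ⟨(⟨x.unshift ν, μ, ν, h⟩ : Plaq P j).src, (⟨x.unshift ν, μ, ν, h⟩ : Plaq P j).μ⟩) + t • ((Complex.I * (η : ℂ)) • (Pi.single (⟨x, μ⟩ : PBond P j) E : PBond P j → Matrix (Fin 2) (Fin 2) ℂ) ⟨(⟨x.unshift ν, μ, ν, h⟩ : Plaq P j).src, (⟨x.unshift ν, μ, ν, h⟩ : Plaq P j).μ⟩)) * exp (((Complex.I * (η : ℂ)) • A ⟨(⟨x.unshift ν, μ, ν, h⟩ : Plaq P j).src.shift (⟨x.unshift ν, μ, ν, h⟩ : Plaq P j).μ, (⟨x.unshift ν, μ, ν, h⟩ : Plaq P j).ν⟩) + t • ((Complex.I * (η : ℂ)) • (Pi.single (⟨x, μ⟩ : PBond P j) E : PBond P j → Matrix (Fin 2) (Fin 2) ℂ) ⟨(⟨x.unshift ν, μ, ν, h⟩ :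 Plaq P j).src.shift (⟨x.unshift ν, μ, ν, h⟩ : Plaq P j).μ, (⟨x.unshift ν, μ, ν, h⟩ : Plaq P j).ν⟩)) * exp ((-((Complex.I * (η : ℂ)) • A ⟨(⟨x.unshift ν, μ, ν, h⟩ : Plaq P j).src.shift (⟨x.unshift ν, μ, ν, h⟩ : Plaq P j).ν, (⟨x.unshift ν, μ, ν, h⟩ : Plaq P j).μ⟩)) + t • (-((Complex.I * (η : ℂ)) • (Pi.single (⟨x, μ⟩ : PBond P j) E : PBond P j → Matrix (Fin 2) (Fin 2) ℂ) ⟨(⟨x.unshift ν, μ, ν, h⟩ : Plaq P j).src.shift (⟨x.unshift ν, μ, ν, h⟩ : Plaq P j).ν, (⟨x.unshift ν, μ, ν, h⟩ : Plaq P j).μ⟩))) * exp ((-((Complex.I * (η : ℂ)) • A ⟨(⟨x.unshift ν, μ, ν, h⟩ : Plaq P j).src, (⟨x.unshift ν, μ, ν, h⟩ : Plaq P j).ν⟩)) + t • (-((Complex.I * (η : ℂ)) • (Pi.single (⟨x, μ⟩ : PBond P j) E : PBond P j → Matrix (Fin 2) (Fin 2) ℂ) ⟨(⟨x.unshift ν,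 μ, ν, h⟩ : Plaq P j).src, (⟨x.unshift ν, μ, ν, h⟩ : Plaq P j).ν⟩)))) + (2 : ℂ)⁻¹ * Matrix.trace ((((Complex.I * (η : ℂ)) • A ⟨(⟨x.unshift ν, μ, ν, h⟩ : Plaq P j).src, (⟨x.unshift ν, μ, ν, h⟩ : Plaq P j).μ⟩) + t • ((Complex.I * (η : ℂ)) • (Pi.single (⟨x, μ⟩ : PBond P j) E : PBond P j → Matrix (Fin 2) (Fin 2) ℂ) ⟨(⟨x.unshift ν, μ, ν, h⟩ : Plaq P j).src, (⟨x.unshift ν, μ, ν, h⟩ : Plaq P j).μ⟩)) + (((Complex.I * (η : ℂ)) • A ⟨(⟨x.unshift ν, μ, ν, h⟩ : Plaq P j).src.shift (⟨x.unshift ν, μ, ν, h⟩ : Plaq P j).μ, (⟨x.unshift ν, μ, ν, h⟩ : Plaq P j).ν⟩) + t • ((Complex.I * (η : ℂ)) • (Pi.single (⟨x, μ⟩ : PBond P j) E : PBond P j → Matrix (Fin 2) (Fin 2) ℂ) ⟨(⟨x.unshift ν, μ, ν, h⟩ : Plaq P j).src.shift (⟨x.unshift ν, μ, ν, h⟩ :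 Plaq P j).μ, (⟨x.unshift ν, μ, ν, h⟩ : Plaq P j).ν⟩)) + ((-((Complex.I * (η : ℂ)) • A ⟨(⟨x.unshift ν, μ, ν, h⟩ : Plaq P j).src.shift (⟨x.unshift ν, μ, ν, h⟩ : Plaq P j).ν, (⟨x.unshift ν, μ, ν, h⟩ : Plaq P j).μ⟩)) + t • (-((Complex.I * (η : ℂ)) • (Pi.single (⟨x, μ⟩ : PBond P j) E : PBond P j → Matrix (Fin 2) (Fin 2) ℂ) ⟨(⟨x.unshift ν, μ, ν, h⟩ : Plaq P j).src.shift (⟨x.unshift ν, μ, ν, h⟩ : Plaq P j).ν, (⟨x.unshift ν, μ, ν, h⟩ : Plaq P j).μ⟩))) + ((-((Complex.I * (η : ℂ)) • A ⟨(⟨x.unshift ν, μ, ν, h⟩ : Plaq P j).src, (⟨x.unshift ν, μ, ν, h⟩ : Plaq P j).ν⟩)) + t • (-((Complex.I * (η : ℂ)) • (Pi.single (⟨x, μ⟩ : PBond P j) E : PBond P j → Matrix (Fin 2) (Fin 2) ℂ) ⟨(⟨x.unshift ν, μ, ν, h⟩ : Plaq P j).src, (⟨x.unshift ν, μ, ν,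 h⟩ : Plaq P j).ν⟩)))) + (4 : ℂ)⁻¹ * Matrix.trace (((((Complex.I * (η : ℂ)) • A ⟨(⟨x.unshift ν, μ, ν, h⟩ : Plaq P j).src, (⟨x.unshift ν, μ, ν, h⟩ : Plaq P j).μ⟩) + t • ((Complex.I * (η : ℂ)) • (Pi.single (⟨x, μ⟩ : PBond P j) E : PBond P j → Matrix (Fin 2) (Fin 2) ℂ) ⟨(⟨x.unshift ν, μ, ν, h⟩ : Plaq P j).src, (⟨x.unshift ν, μ, ν, h⟩ : Plaq P j).μ⟩)) + (((Complex.I * (η : ℂ)) • A ⟨(⟨x.unshift ν, μ, ν, h⟩ : Plaq P j).src.shift (⟨x.unshift ν, μ, ν, h⟩ : Plaq P j).μ, (⟨x.unshift ν, μ, ν, h⟩ : Plaq P j).ν⟩) + t • ((Complex.I * (η : ℂ)) • (Pi.single (⟨x, μ⟩ : PBond P j) E : PBond P j → Matrix (Fin 2) (Fin 2) ℂ) ⟨(⟨x.unshift ν, μ, ν, h⟩ : Plaq P j).src.shift (⟨x.unshift ν, μ, ν, h⟩ : Plaq P j).μ, (⟨x.unshift ν, μ, ν, h⟩ : Plaq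 P j).ν⟩)) + ((-((Complex.I * (η : ℂ)) • A ⟨(⟨x.unshift ν, μ, ν, h⟩ : Plaq P j).src.shift (⟨x.unshift ν, μ, ν, h⟩ : Plaq P j).ν, (⟨x.unshift ν, μ, ν, h⟩ : Plaq P j).μ⟩)) + t • (-((Complex.I * (η : ℂ)) • (Pi.single (⟨x, μ⟩ : PBond P j) E : PBond P j → Matrix (Fin 2) (Fin 2) ℂ) ⟨(⟨x.unshift ν, μ, ν, h⟩ : Plaq P j).src.shift (⟨x.unshift ν, μ, ν, h⟩ : Plaq P j).ν, (⟨x.unshift ν, μ, ν, h⟩ : Plaq P j).μ⟩))) + ((-((Complex.I * (η : ℂ)) • A ⟨(⟨x.unshift ν, μ, ν, h⟩ : Plaq P j).src, (⟨x.unshift ν, μ, ν, h⟩ : Plaq P j).ν⟩)) + t • (-((Complex.I * (η : ℂ)) • (Pi.single (⟨x, μ⟩ : PBond P j) E : PBond P j → Matrix (Fin 2) (Fin 2) ℂ) ⟨(⟨x.unshift ν, μ, ν, h⟩ : Plaq P j).src, (⟨x.unshift ν, μ, ν, h⟩ : Plaq P j).ν⟩)))) ^ 2))) =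
      fun t : ℂ => (1 - (2 : ℂ)⁻¹ * Matrix.trace (exp ((Complex.I * (η : ℂ)) • A ⟨x.unshift ν, μ⟩) * exp ((Complex.I * (η : ℂ)) • A ⟨(x.unshift ν).shift μ, ν⟩) * exp ((-((Complex.I * (η : ℂ)) • A ⟨x, μ⟩)) + t • (-((Complex.I * (η : ℂ)) • E))) * exp (-((Complex.I * (η : ℂ)) • A ⟨x.unshift ν, ν⟩))) + (2 : ℂ)⁻¹ * Matrix.trace (((Complex.I * (η : ℂ)) • A ⟨x.unshift ν, μ⟩) + ((Complex.I * (η : ℂ)) • A ⟨(x.unshift ν).shift μ, ν⟩) + ((-((Complex.I * (η : ℂ)) • A ⟨x, μ⟩)) + t • (-((Complex.I * (η : ℂ)) • E))) + (-((Complex.I * (η : ℂ)) • A ⟨x.unshift ν, ν⟩))) + (4 : ℂ)⁻¹ * Matrix.trace ((((Complex.I * (η : ℂ)) • A ⟨x.unshift ν, μ⟩) + ((Complex.I * (η : ℂ)) • A ⟨(x.unshift ν).shift μ, ν⟩) + ((-((Complex.I * (η : ℂ)) • A ⟨x, μ⟩)) + t • (-((Complex.I * (η : ℂ)) • E))) +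 (-((Complex.I * (η : ℂ)) • A ⟨x.unshift ν, ν⟩))) ^ 2)) := by
    funext t
    simp only [Site.shift_unshift, Pi.single_eq_same, Pi.single_apply, if_neg m1, if_neg m2, if_neg m4, smul_zero, neg_zero, add_zero, smul_neg]
  rw [F1, F3]
  -- the sixteen letters of the pair lemma
  have nc : ∀ X : Matrix (Fin 2) (Fin 2) ℂ, ‖(Complex.I * (η : ℂ)) • X‖ = η * ‖X‖ := norm_cI_smul hη
  have hH : ‖((Complex.I * (η : ℂ)) • E)‖ ≤ η := by rw [nc]; exact (mul_le_mul_of_nonneg_left hE hη.le).trans (by rw [mul_one])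
  have hm0 : 0 ≤ η * s := by positivity
  have bY : ∀ b' : PBond P j, distSite (Mk P j) b'.src x ≤ 2 → ‖(Complex.I * (η : ℂ)) • A b'‖ ≤ η * s := fun b' hd => by
    rw [nc]; exact mul_le_mul_of_nonneg_left (hA b' hd) hη.le
  have bYn : ∀ b' : PBond P j, distSite (Mk P j) b'.src x ≤ 2 → ‖-((Complex.I * (η : ℂ)) • A b')‖ ≤ η * s := fun b' hd => by
    rw [norm_neg]; exact bY b' hd
  have dd : ∀ b₁ b₂ : PBond P j, ‖A b₁ - A b₂‖ ≤ η * g →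
      ‖(Complex.I * (η : ℂ)) • A b₁ - (Complex.I * (η : ℂ)) • A b₂‖ ≤ η * (η * g) := fun b₁ b₂ hb => by
    rw [← smul_sub, nc]; exact mul_le_mul_of_nonneg_left hb hη.le
  have ddn : ∀ b₁ b₂ : PBond P j, ‖A b₁ - A b₂‖ ≤ η * g →
      ‖-((Complex.I * (η : ℂ)) • A b₁) - -((Complex.I * (η : ℂ)) • A b₂)‖ ≤ η * (η * g) := fun b₁ b₂ hb => by
    rw [neg_sub_neg, ← smul_sub, nc, norm_sub_rev]; exact mul_le_mul_of_nonneg_left hb hη.le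
  have dpn : ∀ b₁ b₂ : PBond P j, ‖A b₁ - A b₂‖ ≤ η * g →
      ‖(Complex.I * (η : ℂ)) • A b₁ + -((Complex.I * (η : ℂ)) • A b₂)‖ ≤ η * (η * g) := fun b₁ b₂ hb => by
    rw [← sub_eq_add_neg, ← smul_sub, nc]; exact mul_le_mul_of_nonneg_left hb hη.le
  have e2 : ((x.unshift ν).shift μ).shift ν = x.shift μ := by rw [unshift_shift_comm, Site.shift_unshift]
  have d1 := dd ⟨x, μ⟩ ⟨x.unshift ν, μ⟩ (by simpa only [Site.shift_unshift] using hD' (x.unshift ν) μ ν (du ν))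
  have d2 := dd ⟨x.shift μ, ν⟩ ⟨(x.unshift ν).shift μ, ν⟩ (by simpa only [e2] using hD' ((x.unshift ν).shift μ) ν ν (dus ν μ))
  have d3 := ddn ⟨x.shift ν, μ⟩ ⟨x, μ⟩ (hD' x μ ν d0)
  have d4 := ddn ⟨x, ν⟩ ⟨x.unshift ν, ν⟩ (by simpa only [Site.shift_unshift] using hD' (x.unshift ν) ν ν (du ν))
  have hS := dpn ⟨x, μ⟩ ⟨x.shift ν, μ⟩ (by rw [norm_sub_rev]; exact hD' x μ ν d0)
  have hT := dpn ⟨x.shift μ, ν⟩ ⟨x, ν⟩ (hD' x ν μ d0)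
  have hm1 : η * s + s * ‖((Complex.I * (η : ℂ)) • E)‖ ≤ 1 := by nlinarith [norm_nonneg ((Complex.I * (η : ℂ)) • E)]
  have dsμ := dsh μ
  have dsν := dsh ν
  have duν := du ν
  have dusνμ := dus ν μ
  have key := norm_deriv_pair13_le ((Complex.I * (η : ℂ)) • A ⟨x, μ⟩) ((Complex.I * (η : ℂ)) • A ⟨x.shift μ, ν⟩) (-((Complex.I * (η : ℂ)) • A ⟨x.shift ν, μ⟩)) (-((Complex.I * (η : ℂ)) • A ⟨x, ν⟩)) ((Complex.I * (η : ℂ)) • A ⟨x.unshift ν, μ⟩) ((Complex.I * (η : ℂ)) • A ⟨(x.unshift ν).shift μ, ν⟩) (-((Complex.I * (η : ℂ)) • A ⟨x, μ⟩)) (-((Complex.I * (η : ℂ)) • A ⟨x.unshift ν, ν⟩)) ((Complex.I * (η : ℂ)) • E) hm0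
    (bY _ (by assumption)) (bY _ (by assumption)) (bYn _ (by assumption)) (bYn _ (by assumption)) (bY _ (by assumption)) (bY _ (by assumption)) (bYn _ (by assumption)) (bYn _ (by assumption)) d1 d2 d3 d4 hS hT hs hm1
  exact key.trans (pair_arith_local hη hs hg (norm_nonneg _) hH)


/-- **THE (4,2)-PAIR AT THE LATTICE, LOCAL SIZES**: for `b = ⟨x₀, μ⟩` and `ν < μ`, the plaquettes `p_{νμ}(x₀ − e_ν)` (slot 2) and `p_{νμ}(x₀)` (slot 4) contribute
together at most `η⁴(20sg + ηg² + 1408s³)` under the same local sizes. [cite: Balaban1985Variational, (90)-(96) pp.291-292, (98) p.293] -/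
theorem norm_pair42_le_local (hη : 0 < η) {s g : ℝ} (hs : 0 < s) (hg : 0 ≤ g) (hηs : η * s ≤ 1 / 2)
    (A : PBond P j → Matrix (Fin 2) (Fin 2) ℂ) (x₀ : Site P j)
    (hA : ∀ b' : PBond P j, distSite (Mk P j) b'.src x₀ ≤ 2 → ‖A b'‖ ≤ s)
    (hD : ∀ (s' : Site P j) (μ ν : Fin P.d), distSite (Mk P j) s' x₀ ≤ 2 → η⁻¹ * ‖A ⟨s'.shift ν, μ⟩ - A ⟨s', μ⟩‖ ≤ g)
    (E : Matrix (Fin 2) (Fin 2) ℂ) (hE : ‖E‖ ≤ 1) (b : PBond P j) (hb : b.src = x₀) (ν : Fin P.d) (h : ν < b.dir) :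
    ‖deriv (fun t : ℂ => (1 - (2 : ℂ)⁻¹ * Matrix.trace (exp (((Complex.I * (η : ℂ)) • A ⟨(⟨b.src.unshift ν, ν, b.dir, h⟩ : Plaq P j).src, (⟨b.src.unshift ν, ν, b.dir, h⟩ : Plaq P j).μ⟩) + t • ((Complex.I * (η : ℂ)) • (Pi.single b E : PBond P j → Matrix (Fin 2) (Fin 2) ℂ) ⟨(⟨b.src.unshift ν, ν, b.dir, h⟩ : Plaq P j).src, (⟨b.src.unshift ν, ν, b.dir, h⟩ : Plaq P j).μ⟩)) * exp (((Complex.I * (η : ℂ)) • A ⟨(⟨b.src.unshift ν, ν, b.dir, h⟩ : Plaq P j).src.shift (⟨b.src.unshift ν, ν, b.dir, h⟩ : Plaq P j).μ, (⟨b.src.unshift ν, ν, b.dir, h⟩ : Plaq P j).ν⟩) + t • ((Complex.I * (η : ℂ)) • (Pi.single b E : PBond P j → Matrix (Fin 2) (Fin 2) ℂ) ⟨(⟨b.src.unshift ν, ν, b.dir, h⟩ : Plaq P j).src.shift (⟨b.src.unshift ν, ν, b.dir, h⟩ : Plaq P j).μ, (⟨b.src.unshift ν, ν, b.dir, h⟩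 : Plaq P j).ν⟩)) * exp ((-((Complex.I * (η : ℂ)) • A ⟨(⟨b.src.unshift ν, ν, b.dir, h⟩ : Plaq P j).src.shift (⟨b.src.unshift ν, ν, b.dir, h⟩ : Plaq P j).ν, (⟨b.src.unshift ν, ν, b.dir, h⟩ : Plaq P j).μ⟩)) + t • (-((Complex.I * (η : ℂ)) • (Pi.single b E : PBond P j → Matrix (Fin 2) (Fin 2) ℂ) ⟨(⟨b.src.unshift ν, ν, b.dir, h⟩ : Plaq P j).src.shift (⟨b.src.unshift ν, ν, b.dir, h⟩ : Plaq P j).ν, (⟨b.src.unshift ν, ν, b.dir, h⟩ : Plaq P j).μ⟩))) * exp ((-((Complex.I * (η : ℂ)) • A ⟨(⟨b.src.unshift ν, ν, b.dir, h⟩ : Plaq P j).src, (⟨b.src.unshift ν, ν, b.dir, h⟩ : Plaq P j).ν⟩)) + t • (-((Complex.I * (η : ℂ)) • (Pi.single b E : PBond P j → Matrix (Fin 2) (Fin 2) ℂ) ⟨(⟨b.src.unshift ν, ν, b.dir, h⟩ : Plaq P j).src, (⟨b.src.unshift ν, ν, b.dir, h⟩ : Plaq P j).ν⟩)))) + (2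 : ℂ)⁻¹ * Matrix.trace ((((Complex.I * (η : ℂ)) • A ⟨(⟨b.src.unshift ν, ν, b.dir, h⟩ : Plaq P j).src, (⟨b.src.unshift ν, ν, b.dir, h⟩ : Plaq P j).μ⟩) + t • ((Complex.I * (η : ℂ)) • (Pi.single b E : PBond P j → Matrix (Fin 2) (Fin 2) ℂ) ⟨(⟨b.src.unshift ν, ν, b.dir, h⟩ : Plaq P j).src, (⟨b.src.unshift ν, ν, b.dir, h⟩ : Plaq P j).μ⟩)) + (((Complex.I * (η : ℂ)) • A ⟨(⟨b.src.unshift ν, ν, b.dir, h⟩ : Plaq P j).src.shift (⟨b.src.unshift ν, ν, b.dir, h⟩ : Plaq P j).μ, (⟨b.src.unshift ν, ν, b.dir, h⟩ : Plaq P j).ν⟩) + t • ((Complex.I * (η : ℂ)) • (Pi.single b E : PBond P j → Matrix (Fin 2) (Fin 2) ℂ) ⟨(⟨b.src.unshift ν, ν, b.dir, h⟩ : Plaq P j).src.shift (⟨b.src.unshift ν, ν, b.dir, h⟩ : Plaq P j).μ, (⟨b.src.unshift ν, ν, b.dir, h⟩ : Plaq P j).ν⟩)) + ((-((Complex.I *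 (η : ℂ)) • A ⟨(⟨b.src.unshift ν, ν, b.dir, h⟩ : Plaq P j).src.shift (⟨b.src.unshift ν, ν, b.dir, h⟩ : Plaq P j).ν, (⟨b.src.unshift ν, ν, b.dir, h⟩ : Plaq P j).μ⟩)) + t • (-((Complex.I * (η : ℂ)) • (Pi.single b E : PBond P j → Matrix (Fin 2) (Fin 2) ℂ) ⟨(⟨b.src.unshift ν, ν, b.dir, h⟩ : Plaq P j).src.shift (⟨b.src.unshift ν, ν, b.dir, h⟩ : Plaq P j).ν, (⟨b.src.unshift ν, ν, b.dir, h⟩ : Plaq P j).μ⟩))) + ((-((Complex.I * (η : ℂ)) • A ⟨(⟨b.src.unshift ν, ν, b.dir, h⟩ : Plaq P j).src, (⟨b.src.unshift ν, ν, b.dir, h⟩ : Plaq P j).ν⟩)) + t • (-((Complex.I * (η : ℂ)) • (Pi.single b E : PBond P j → Matrix (Fin 2) (Fin 2) ℂ) ⟨(⟨b.src.unshift ν, ν, b.dir, h⟩ : Plaq P j).src, (⟨b.src.unshift ν, ν, b.dir, h⟩ : Plaq P j).ν⟩)))) + (4 : ℂ)⁻¹ * Matrix.trace (((((Complex.I *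 (η : ℂ)) • A ⟨(⟨b.src.unshift ν, ν, b.dir, h⟩ : Plaq P j).src, (⟨b.src.unshift ν, ν, b.dir, h⟩ : Plaq P j).μ⟩) + t • ((Complex.I * (η : ℂ)) • (Pi.single b E : PBond P j → Matrix (Fin 2) (Fin 2) ℂ) ⟨(⟨b.src.unshift ν, ν, b.dir, h⟩ : Plaq P j).src, (⟨b.src.unshift ν, ν, b.dir, h⟩ : Plaq P j).μ⟩)) + (((Complex.I * (η : ℂ)) • A ⟨(⟨b.src.unshift ν, ν, b.dir, h⟩ : Plaq P j).src.shift (⟨b.src.unshift ν, ν, b.dir, h⟩ : Plaq P j).μ, (⟨b.src.unshift ν, ν, b.dir, h⟩ : Plaq P j).ν⟩) + t • ((Complex.I * (η : ℂ)) • (Pi.single b E : PBond P j → Matrix (Fin 2) (Fin 2) ℂ) ⟨(⟨b.src.unshift ν, ν, b.dir, h⟩ : Plaq P j).src.shift (⟨b.src.unshift ν, ν, b.dir, h⟩ : Plaq P j).μ, (⟨b.src.unshift ν, ν, b.dir, h⟩ : Plaq P j).ν⟩)) + ((-((Complex.I * (η : ℂ)) • A ⟨(⟨b.src.unshift ν,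 ν, b.dir, h⟩ : Plaq P j).src.shift (⟨b.src.unshift ν, ν, b.dir, h⟩ : Plaq P j).ν, (⟨b.src.unshift ν, ν, b.dir, h⟩ : Plaq P j).μ⟩)) + t • (-((Complex.I * (η : ℂ)) • (Pi.single b E : PBond P j → Matrix (Fin 2) (Fin 2) ℂ) ⟨(⟨b.src.unshift ν, ν, b.dir, h⟩ : Plaq P j).src.shift (⟨b.src.unshift ν, ν, b.dir, h⟩ : Plaq P j).ν, (⟨b.src.unshift ν, ν, b.dir, h⟩ : Plaq P j).μ⟩))) + ((-((Complex.I * (η : ℂ)) • A ⟨(⟨b.src.unshift ν, ν, b.dir, h⟩ : Plaq P j).src, (⟨b.src.unshift ν, ν, b.dir, h⟩ : Plaq P j).ν⟩)) + t • (-((Complex.I * (η : ℂ)) • (Pi.single b E : PBond P j → Matrix (Fin 2) (Fin 2) ℂ) ⟨(⟨b.src.unshift ν, ν, b.dir, h⟩ : Plaq P j).src, (⟨b.src.unshift ν, ν, b.dir, h⟩ : Plaq P j).ν⟩)))) ^ 2))) 0 + deriv (fun t : ℂ => (1 - (2 : ℂ)⁻¹ * Matrix.trace (exp (((Complex.I *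 (η : ℂ)) • A ⟨(⟨b.src, ν, b.dir, h⟩ : Plaq P j).src, (⟨b.src, ν, b.dir, h⟩ : Plaq P j).μ⟩) + t • ((Complex.I * (η : ℂ)) • (Pi.single b E : PBond P j → Matrix (Fin 2) (Fin 2) ℂ) ⟨(⟨b.src, ν, b.dir, h⟩ : Plaq P j).src, (⟨b.src, ν, b.dir, h⟩ : Plaq P j).μ⟩)) * exp (((Complex.I * (η : ℂ)) • A ⟨(⟨b.src, ν, b.dir, h⟩ : Plaq P j).src.shift (⟨b.src, ν, b.dir, h⟩ : Plaq P j).μ, (⟨b.src, ν, b.dir, h⟩ : Plaq P j).ν⟩) + t • ((Complex.I * (η : ℂ)) • (Pi.single b E : PBond P j → Matrix (Fin 2) (Fin 2) ℂ) ⟨(⟨b.src, ν, b.dir, h⟩ : Plaq P j).src.shift (⟨b.src, ν, b.dir, h⟩ : Plaq P j).μ, (⟨b.src, ν, b.dir, h⟩ : Plaq P j).ν⟩)) * exp ((-((Complex.I * (η : ℂ)) • A ⟨(⟨b.src, ν, b.dir, h⟩ : Plaq P j).src.shift (⟨b.src, ν, b.dir, h⟩ : Plaq P j).ν, (⟨b.src,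 ν, b.dir, h⟩ : Plaq P j).μ⟩)) + t • (-((Complex.I * (η : ℂ)) • (Pi.single b E : PBond P j → Matrix (Fin 2) (Fin 2) ℂ) ⟨(⟨b.src, ν, b.dir, h⟩ : Plaq P j).src.shift (⟨b.src, ν, b.dir, h⟩ : Plaq P j).ν, (⟨b.src, ν, b.dir, h⟩ : Plaq P j).μ⟩))) * exp ((-((Complex.I * (η : ℂ)) • A ⟨(⟨b.src, ν, b.dir, h⟩ : Plaq P j).src, (⟨b.src, ν, b.dir, h⟩ : Plaq P j).ν⟩)) + t • (-((Complex.I * (η : ℂ)) • (Pi.single b E : PBond P j → Matrix (Fin 2) (Fin 2) ℂ) ⟨(⟨b.src, ν, b.dir, h⟩ : Plaq P j).src, (⟨b.src, ν, b.dir, h⟩ : Plaq P j).ν⟩)))) + (2 : ℂ)⁻¹ * Matrix.trace ((((Complex.I * (η : ℂ)) • A ⟨(⟨b.src, ν, b.dir, h⟩ : Plaq P j).src, (⟨b.src, ν, b.dir, h⟩ : Plaq P j).μ⟩) + t • ((Complex.I * (η : ℂ)) • (Pi.single b E : PBond P j → Matrix (Fin 2) (Fin 2) ℂ) ⟨(⟨b.src,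 ν, b.dir, h⟩ : Plaq P j).src, (⟨b.src, ν, b.dir, h⟩ : Plaq P j).μ⟩)) + (((Complex.I * (η : ℂ)) • A ⟨(⟨b.src, ν, b.dir, h⟩ : Plaq P j).src.shift (⟨b.src, ν, b.dir, h⟩ : Plaq P j).μ, (⟨b.src, ν, b.dir, h⟩ : Plaq P j).ν⟩) + t • ((Complex.I * (η : ℂ)) • (Pi.single b E : PBond P j → Matrix (Fin 2) (Fin 2) ℂ) ⟨(⟨b.src, ν, b.dir, h⟩ : Plaq P j).src.shift (⟨b.src, ν, b.dir, h⟩ : Plaq P j).μ, (⟨b.src, ν, b.dir, h⟩ : Plaq P j).ν⟩)) + ((-((Complex.I * (η : ℂ)) • A ⟨(⟨b.src, ν, b.dir, h⟩ : Plaq P j).src.shift (⟨b.src, ν, b.dir, h⟩ : Plaq P j).ν, (⟨b.src, ν, b.dir, h⟩ : Plaq P j).μ⟩)) + t • (-((Complex.I * (η : ℂ)) • (Pi.single b E : PBond P j → Matrix (Fin 2) (Fin 2) ℂ) ⟨(⟨b.src, ν, b.dir, h⟩ : Plaq P j).src.shift (⟨b.src, ν, b.dir, h⟩ : Plaq P j).ν,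 (⟨b.src, ν, b.dir, h⟩ : Plaq P j).μ⟩))) + ((-((Complex.I * (η : ℂ)) • A ⟨(⟨b.src, ν, b.dir, h⟩ : Plaq P j).src, (⟨b.src, ν, b.dir, h⟩ : Plaq P j).ν⟩)) + t • (-((Complex.I * (η : ℂ)) • (Pi.single b E : PBond P j → Matrix (Fin 2) (Fin 2) ℂ) ⟨(⟨b.src, ν, b.dir, h⟩ : Plaq P j).src, (⟨b.src, ν, b.dir, h⟩ : Plaq P j).ν⟩)))) + (4 : ℂ)⁻¹ * Matrix.trace (((((Complex.I * (η : ℂ)) • A ⟨(⟨b.src, ν, b.dir, h⟩ : Plaq P j).src, (⟨b.src, ν, b.dir, h⟩ : Plaq P j).μ⟩) + t • ((Complex.I * (η : ℂ)) • (Pi.single b E : PBond P j → Matrix (Fin 2) (Fin 2) ℂ) ⟨(⟨b.src, ν, b.dir, h⟩ : Plaq P j).src, (⟨b.src, ν, b.dir, h⟩ : Plaq P j).μ⟩)) + (((Complex.I * (η : ℂ)) • A ⟨(⟨b.src, ν, b.dir, h⟩ : Plaq P j).src.shift (⟨b.src, ν, b.dir, h⟩ : Plaq P j).μ, (⟨b.src,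 ν, b.dir, h⟩ : Plaq P j).ν⟩) + t • ((Complex.I * (η : ℂ)) • (Pi.single b E : PBond P j → Matrix (Fin 2) (Fin 2) ℂ) ⟨(⟨b.src, ν, b.dir, h⟩ : Plaq P j).src.shift (⟨b.src, ν, b.dir, h⟩ : Plaq P j).μ, (⟨b.src, ν, b.dir, h⟩ : Plaq P j).ν⟩)) + ((-((Complex.I * (η : ℂ)) • A ⟨(⟨b.src, ν, b.dir, h⟩ : Plaq P j).src.shift (⟨b.src, ν, b.dir, h⟩ : Plaq P j).ν, (⟨b.src, ν, b.dir, h⟩ : Plaq P j).μ⟩)) + t • (-((Complex.I * (η : ℂ)) • (Pi.single b E : PBond P j → Matrix (Fin 2) (Fin 2) ℂ) ⟨(⟨b.src, ν, b.dir, h⟩ : Plaq P j).src.shift (⟨b.src, ν, b.dir, h⟩ : Plaq P j).ν, (⟨b.src, ν, b.dir, h⟩ : Plaq P j).μ⟩))) + ((-((Complex.I * (η : ℂ)) • A ⟨(⟨b.src, ν, b.dir, h⟩ : Plaq P j).src, (⟨b.src, ν, b.dir, h⟩ : Plaq P j).ν⟩)) + t • (-((Complex.I * (η : ℂ)) • (Pi.single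 b E : PBond P j → Matrix (Fin 2) (Fin 2) ℂ) ⟨(⟨b.src, ν, b.dir, h⟩ : Plaq P j).src, (⟨b.src, ν, b.dir, h⟩ : Plaq P j).ν⟩)))) ^ 2))) 0‖ ≤ η ^ 4 * (20 * s * g + η * g ^ 2 + 1408 * s ^ 3) := by
  obtain ⟨x, μ⟩ := b
  change x = x₀ at hb
  subst hb
  -- the sites involved are within sup-distance 2 of the centre
  have d0 : distSite (Mk P j) x x ≤ 2 := by rw [B5Prop12FieldsLattice.distSite_self]; norm_num
  have dsh : ∀ κ : Fin P.d, distSite (Mk P j) (x.shift κ) x ≤ 2 := fun κ => (distSite_shift_le_one x κ).trans (by norm_num)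
  have dun : ∀ κ : Fin P.d, distSite (Mk P j) (x.unshift κ) x ≤ 1 := fun κ => by
    have h := distSite_shift_le_one (x.unshift κ) κ
    rw [Site.shift_unshift] at h
    rwa [distSite_comm]
  have du : ∀ κ : Fin P.d, distSite (Mk P j) (x.unshift κ) x ≤ 2 := fun κ => (dun κ).trans (by norm_num)
  have dus : ∀ κ κ' : Fin P.d, distSite (Mk P j) ((x.unshift κ).shift κ') x ≤ 2 := fun κ κ' => by
    have h := distSite_triangle (Mk P j) ((x.unshift κ).shift κ') (x.unshift κ) x
    linarith [distSite_shift_le_one (x.unshift κ) κ', dun κ]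
  have hμν : ν ≠ μ := ne_of_lt h
  have hD' : ∀ (s' : Site P j) (μ' ν' : Fin P.d), distSite (Mk P j) s' x ≤ 2 → ‖A ⟨s'.shift ν', μ'⟩ - A ⟨s', μ'⟩‖ ≤ η * g :=
    fun s' μ' ν' hd => (inv_mul_le_iff₀ hη).mp (hD s' μ' ν' hd)
  have n1 : (⟨x, ν⟩ : PBond P j) ≠ ⟨x, μ⟩ := fun e => hμν (by simp only [PBond.mk.injEq] at e; exact e.2)
  have n2 : (⟨x.shift ν, μ⟩ : PBond P j) ≠ ⟨x, μ⟩ := fun e => shift_ne_self x ν (by simp only [PBond.mk.injEq] at e; exact e.1)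
  have n3 : (⟨x.shift μ, ν⟩ : PBond P j) ≠ ⟨x, μ⟩ := fun e => hμν (by simp only [PBond.mk.injEq] at e; exact e.2)
  have m1 : (⟨x.unshift ν, ν⟩ : PBond P j) ≠ ⟨x, μ⟩ := fun e => hμν (by simp only [PBond.mk.injEq] at e; exact e.2)
  have m3 : (⟨(x.unshift ν).shift μ, ν⟩ : PBond P j) ≠ ⟨x, μ⟩ := fun e => hμν (by simp only [PBond.mk.injEq] at e; exact e.2)
  have m4 : (⟨x.unshift ν, μ⟩ : PBond P j) ≠ ⟨x, μ⟩ := fun e => unshift_ne_self x ν (by simp only [PBond.mk.injEq] at e; exact e.1)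
  have F2 : (fun t : ℂ => (1 - (2 : ℂ)⁻¹ * Matrix.trace (exp (((Complex.I * (η : ℂ)) • A ⟨(⟨x.unshift ν, ν, μ, h⟩ : Plaq P j).src, (⟨x.unshift ν, ν, μ, h⟩ : Plaq P j).μ⟩) + t • ((Complex.I * (η : ℂ)) • (Pi.single (⟨x, μ⟩ : PBond P j) E : PBond P j → Matrix (Fin 2) (Fin 2) ℂ) ⟨(⟨x.unshift ν, ν, μ, h⟩ : Plaq P j).src, (⟨x.unshift ν, ν, μ, h⟩ : Plaq P j).μ⟩)) * exp (((Complex.I * (η : ℂ)) • A ⟨(⟨x.unshift ν, ν, μ, h⟩ : Plaq P j).src.shift (⟨x.unshift ν, ν, μ, h⟩ : Plaq P j).μ, (⟨x.unshift ν, ν, μ, h⟩ : Plaq P j).ν⟩) + t • ((Complex.I * (η : ℂ)) • (Pi.single (⟨x, μ⟩ : PBond P j) E : PBond P j → Matrix (Fin 2) (Fin 2) ℂ) ⟨(⟨x.unshift ν, ν, μ, h⟩ : Plaq P j).src.shift (⟨x.unshift ν, ν, μ, h⟩ : Plaq P j).μ, (⟨x.unshift ν, ν, μ, h⟩ : Plaq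 P j).ν⟩)) * exp ((-((Complex.I * (η : ℂ)) • A ⟨(⟨x.unshift ν, ν, μ, h⟩ : Plaq P j).src.shift (⟨x.unshift ν, ν, μ, h⟩ : Plaq P j).ν, (⟨x.unshift ν, ν, μ, h⟩ : Plaq P j).μ⟩)) + t • (-((Complex.I * (η : ℂ)) • (Pi.single (⟨x, μ⟩ : PBond P j) E : PBond P j → Matrix (Fin 2) (Fin 2) ℂ) ⟨(⟨x.unshift ν, ν, μ, h⟩ : Plaq P j).src.shift (⟨x.unshift ν, ν, μ, h⟩ : Plaq P j).ν, (⟨x.unshift ν, ν, μ, h⟩ : Plaq P j).μ⟩))) * exp ((-((Complex.I * (η : ℂ)) • A ⟨(⟨x.unshift ν, ν, μ, h⟩ : Plaq P j).src, (⟨x.unshift ν, ν, μ, h⟩ : Plaq P j).ν⟩)) + t • (-((Complex.I * (η : ℂ)) • (Pi.single (⟨x, μ⟩ : PBond P j) E : PBond P j → Matrix (Fin 2) (Fin 2) ℂ) ⟨(⟨x.unshift ν, ν, μ, h⟩ : Plaq P j).src, (⟨x.unshift ν, ν, μ, h⟩ : Plaq P j).ν⟩)))) + (2 : ℂ)⁻¹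 * Matrix.trace ((((Complex.I * (η : ℂ)) • A ⟨(⟨x.unshift ν, ν, μ, h⟩ : Plaq P j).src, (⟨x.unshift ν, ν, μ, h⟩ : Plaq P j).μ⟩) + t • ((Complex.I * (η : ℂ)) • (Pi.single (⟨x, μ⟩ : PBond P j) E : PBond P j → Matrix (Fin 2) (Fin 2) ℂ) ⟨(⟨x.unshift ν, ν, μ, h⟩ : Plaq P j).src, (⟨x.unshift ν, ν, μ, h⟩ : Plaq P j).μ⟩)) + (((Complex.I * (η : ℂ)) • A ⟨(⟨x.unshift ν, ν, μ, h⟩ : Plaq P j).src.shift (⟨x.unshift ν, ν, μ, h⟩ : Plaq P j).μ, (⟨x.unshift ν, ν, μ, h⟩ : Plaq P j).ν⟩) + t • ((Complex.I * (η : ℂ)) • (Pi.single (⟨x, μ⟩ : PBond P j) E : PBond P j → Matrix (Fin 2) (Fin 2) ℂ) ⟨(⟨x.unshift ν, ν, μ, h⟩ : Plaq P j).src.shift (⟨x.unshift ν, ν, μ, h⟩ : Plaq P j).μ, (⟨x.unshift ν, ν, μ, h⟩ : Plaq P j).ν⟩)) + ((-((Complex.I * (η : ℂ)) • A ⟨(⟨x.unshift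 ν, ν, μ, h⟩ : Plaq P j).src.shift (⟨x.unshift ν, ν, μ, h⟩ : Plaq P j).ν, (⟨x.unshift ν, ν, μ, h⟩ : Plaq P j).μ⟩)) + t • (-((Complex.I * (η : ℂ)) • (Pi.single (⟨x, μ⟩ : PBond P j) E : PBond P j → Matrix (Fin 2) (Fin 2) ℂ) ⟨(⟨x.unshift ν, ν, μ, h⟩ : Plaq P j).src.shift (⟨x.unshift ν, ν, μ, h⟩ : Plaq P j).ν, (⟨x.unshift ν, ν, μ, h⟩ : Plaq P j).μ⟩))) + ((-((Complex.I * (η : ℂ)) • A ⟨(⟨x.unshift ν, ν, μ, h⟩ : Plaq P j).src, (⟨x.unshift ν, ν, μ, h⟩ : Plaq P j).ν⟩)) + t • (-((Complex.I * (η : ℂ)) • (Pi.single (⟨x, μ⟩ : PBond P j) E : PBond P j → Matrix (Fin 2) (Fin 2) ℂ) ⟨(⟨x.unshift ν, ν, μ, h⟩ : Plaq P j).src, (⟨x.unshift ν, ν, μ, h⟩ : Plaq P j).ν⟩)))) + (4 : ℂ)⁻¹ * Matrix.trace (((((Complex.I * (η : ℂ)) • A ⟨(⟨x.unshift ν, ν,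 μ, h⟩ : Plaq P j).src, (⟨x.unshift ν, ν, μ, h⟩ : Plaq P j).μ⟩) + t • ((Complex.I * (η : ℂ)) • (Pi.single (⟨x, μ⟩ : PBond P j) E : PBond P j → Matrix (Fin 2) (Fin 2) ℂ) ⟨(⟨x.unshift ν, ν, μ, h⟩ : Plaq P j).src, (⟨x.unshift ν, ν, μ, h⟩ : Plaq P j).μ⟩)) + (((Complex.I * (η : ℂ)) • A ⟨(⟨x.unshift ν, ν, μ, h⟩ : Plaq P j).src.shift (⟨x.unshift ν, ν, μ, h⟩ : Plaq P j).μ, (⟨x.unshift ν, ν, μ, h⟩ : Plaq P j).ν⟩) + t • ((Complex.I * (η : ℂ)) • (Pi.single (⟨x, μ⟩ : PBond P j) E : PBond P j → Matrix (Fin 2) (Fin 2) ℂ) ⟨(⟨x.unshift ν, ν, μ, h⟩ : Plaq P j).src.shift (⟨x.unshift ν, ν, μ, h⟩ : Plaq P j).μ, (⟨x.unshift ν, ν, μ, h⟩ : Plaq P j).ν⟩)) + ((-((Complex.I * (η : ℂ)) • A ⟨(⟨x.unshift ν, ν, μ, h⟩ : Plaq P j).src.shift (⟨x.unshift ν, ν,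 μ, h⟩ : Plaq P j).ν, (⟨x.unshift ν, ν, μ, h⟩ : Plaq P j).μ⟩)) + t • (-((Complex.I * (η : ℂ)) • (Pi.single (⟨x, μ⟩ : PBond P j) E : PBond P j → Matrix (Fin 2) (Fin 2) ℂ) ⟨(⟨x.unshift ν, ν, μ, h⟩ : Plaq P j).src.shift (⟨x.unshift ν, ν, μ, h⟩ : Plaq P j).ν, (⟨x.unshift ν, ν, μ, h⟩ : Plaq P j).μ⟩))) + ((-((Complex.I * (η : ℂ)) • A ⟨(⟨x.unshift ν, ν, μ, h⟩ : Plaq P j).src, (⟨x.unshift ν, ν, μ, h⟩ : Plaq P j).ν⟩)) + t • (-((Complex.I * (η : ℂ)) • (Pi.single (⟨x, μ⟩ : PBond P j) E : PBond P j → Matrix (Fin 2) (Fin 2) ℂ) ⟨(⟨x.unshift ν, ν, μ, h⟩ : Plaq P j).src, (⟨x.unshift ν, ν, μ, h⟩ : Plaq P j).ν⟩)))) ^ 2))) =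
      fun t : ℂ => (1 - (2 : ℂ)⁻¹ * Matrix.trace (exp ((Complex.I * (η : ℂ)) • A ⟨x.unshift ν, ν⟩) * exp (((Complex.I * (η : ℂ)) • A ⟨x, μ⟩) + t • ((Complex.I * (η : ℂ)) • E)) * exp (-((Complex.I * (η : ℂ)) • A ⟨(x.unshift ν).shift μ, ν⟩)) * exp (-((Complex.I * (η : ℂ)) • A ⟨x.unshift ν, μ⟩))) + (2 : ℂ)⁻¹ * Matrix.trace (((Complex.I * (η : ℂ)) • A ⟨x.unshift ν, ν⟩) + (((Complex.I * (η : ℂ)) • A ⟨x, μ⟩) + t • ((Complex.I * (η : ℂ)) • E)) + (-((Complex.I * (η : ℂ)) • A ⟨(x.unshift ν).shift μ, ν⟩)) + (-((Complex.I * (η : ℂ)) • A ⟨x.unshift ν, μ⟩))) + (4 : ℂ)⁻¹ * Matrix.trace ((((Complex.I * (η : ℂ)) • A ⟨x.unshift ν, ν⟩) + (((Complex.I * (η : ℂ)) • A ⟨x, μ⟩) + t • ((Complex.I * (η : ℂ)) • E)) + (-((Complex.I * (η : ℂ)) • A ⟨(x.unshift ν).shift μ, ν⟩)) + (-((Complex.I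 * (η : ℂ)) • A ⟨x.unshift ν, μ⟩))) ^ 2)) := by
    funext t
    simp only [Site.shift_unshift, Pi.single_eq_same, Pi.single_apply, if_neg m1, if_neg m3, if_neg m4, smul_zero, neg_zero, add_zero]
  have F4 : (fun t : ℂ => (1 - (2 : ℂ)⁻¹ * Matrix.trace (exp (((Complex.I * (η : ℂ)) • A ⟨(⟨x, ν, μ, h⟩ : Plaq P j).src, (⟨x, ν, μ, h⟩ : Plaq P j).μ⟩) + t • ((Complex.I * (η : ℂ)) • (Pi.single (⟨x, μ⟩ : PBond P j) E : PBond P j → Matrix (Fin 2) (Fin 2) ℂ) ⟨(⟨x, ν, μ, h⟩ : Plaq P j).src, (⟨x, ν, μ, h⟩ : Plaq P j).μ⟩)) * exp (((Complex.I * (η : ℂ)) • A ⟨(⟨x, ν, μ, h⟩ : Plaq P j).src.shift (⟨x, ν, μ, h⟩ : Plaq P j).μ, (⟨x, ν, μ, h⟩ : Plaq P j).ν⟩) + t • ((Complex.I * (η : ℂ)) • (Pi.single (⟨x, μ⟩ : PBond P j) E : PBond P j → Matrix (Fin 2) (Fin 2) ℂ) ⟨(⟨x, ν, μ, h⟩ :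 Plaq P j).src.shift (⟨x, ν, μ, h⟩ : Plaq P j).μ, (⟨x, ν, μ, h⟩ : Plaq P j).ν⟩)) * exp ((-((Complex.I * (η : ℂ)) • A ⟨(⟨x, ν, μ, h⟩ : Plaq P j).src.shift (⟨x, ν, μ, h⟩ : Plaq P j).ν, (⟨x, ν, μ, h⟩ : Plaq P j).μ⟩)) + t • (-((Complex.I * (η : ℂ)) • (Pi.single (⟨x, μ⟩ : PBond P j) E : PBond P j → Matrix (Fin 2) (Fin 2) ℂ) ⟨(⟨x, ν, μ, h⟩ : Plaq P j).src.shift (⟨x, ν, μ, h⟩ : Plaq P j).ν, (⟨x, ν, μ, h⟩ : Plaq P j).μ⟩))) * exp ((-((Complex.I * (η : ℂ)) • A ⟨(⟨x, ν, μ, h⟩ : Plaq P j).src, (⟨x, ν, μ, h⟩ : Plaq P j).ν⟩)) + t • (-((Complex.I * (η : ℂ)) • (Pi.single (⟨x, μ⟩ : PBond P j) E : PBond P j → Matrix (Fin 2) (Fin 2) ℂ) ⟨(⟨x, ν, μ, h⟩ : Plaq P j).src, (⟨x, ν, μ, h⟩ : Plaq P j).ν⟩)))) + (2 : ℂ)⁻¹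 * Matrix.trace ((((Complex.I * (η : ℂ)) • A ⟨(⟨x, ν, μ, h⟩ : Plaq P j).src, (⟨x, ν, μ, h⟩ : Plaq P j).μ⟩) + t • ((Complex.I * (η : ℂ)) • (Pi.single (⟨x, μ⟩ : PBond P j) E : PBond P j → Matrix (Fin 2) (Fin 2) ℂ) ⟨(⟨x, ν, μ, h⟩ : Plaq P j).src, (⟨x, ν, μ, h⟩ : Plaq P j).μ⟩)) + (((Complex.I * (η : ℂ)) • A ⟨(⟨x, ν, μ, h⟩ : Plaq P j).src.shift (⟨x, ν, μ, h⟩ : Plaq P j).μ, (⟨x, ν, μ, h⟩ : Plaq P j).ν⟩) + t • ((Complex.I * (η : ℂ)) • (Pi.single (⟨x, μ⟩ : PBond P j) E : PBond P j → Matrix (Fin 2) (Fin 2) ℂ) ⟨(⟨x, ν, μ, h⟩ : Plaq P j).src.shift (⟨x, ν, μ, h⟩ : Plaq P j).μ, (⟨x, ν, μ, h⟩ : Plaq P j).ν⟩)) + ((-((Complex.I * (η : ℂ)) • A ⟨(⟨x, ν, μ, h⟩ : Plaq P j).src.shift (⟨x, ν, μ, h⟩ : Plaq P j).ν, (⟨x,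 ν, μ, h⟩ : Plaq P j).μ⟩)) + t • (-((Complex.I * (η : ℂ)) • (Pi.single (⟨x, μ⟩ : PBond P j) E : PBond P j → Matrix (Fin 2) (Fin 2) ℂ) ⟨(⟨x, ν, μ, h⟩ : Plaq P j).src.shift (⟨x, ν, μ, h⟩ : Plaq P j).ν, (⟨x, ν, μ, h⟩ : Plaq P j).μ⟩))) + ((-((Complex.I * (η : ℂ)) • A ⟨(⟨x, ν, μ, h⟩ : Plaq P j).src, (⟨x, ν, μ, h⟩ : Plaq P j).ν⟩)) + t • (-((Complex.I * (η : ℂ)) • (Pi.single (⟨x, μ⟩ : PBond P j) E : PBond P j → Matrix (Fin 2) (Fin 2) ℂ) ⟨(⟨x, ν, μ, h⟩ : Plaq P j).src, (⟨x, ν, μ, h⟩ : Plaq P j).ν⟩)))) + (4 : ℂ)⁻¹ * Matrix.trace (((((Complex.I * (η : ℂ)) • A ⟨(⟨x, ν, μ, h⟩ : Plaq P j).src, (⟨x, ν, μ, h⟩ : Plaq P j).μ⟩) + t • ((Complex.I * (η : ℂ)) • (Pi.single (⟨x, μ⟩ : PBond P j) E : PBond P j → Matrix (Fin 2) (Fin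 2) ℂ) ⟨(⟨x, ν, μ, h⟩ : Plaq P j).src, (⟨x, ν, μ, h⟩ : Plaq P j).μ⟩)) + (((Complex.I * (η : ℂ)) • A ⟨(⟨x, ν, μ, h⟩ : Plaq P j).src.shift (⟨x, ν, μ, h⟩ : Plaq P j).μ, (⟨x, ν, μ, h⟩ : Plaq P j).ν⟩) + t • ((Complex.I * (η : ℂ)) • (Pi.single (⟨x, μ⟩ : PBond P j) E : PBond P j → Matrix (Fin 2) (Fin 2) ℂ) ⟨(⟨x, ν, μ, h⟩ : Plaq P j).src.shift (⟨x, ν, μ, h⟩ : Plaq P j).μ, (⟨x, ν, μ, h⟩ : Plaq P j).ν⟩)) + ((-((Complex.I * (η : ℂ)) • A ⟨(⟨x, ν, μ, h⟩ : Plaq P j).src.shift (⟨x, ν, μ, h⟩ : Plaq P j).ν, (⟨x, ν, μ, h⟩ : Plaq P j).μ⟩)) + t • (-((Complex.I * (η : ℂ)) • (Pi.single (⟨x, μ⟩ : PBond P j) E : PBond P j → Matrix (Fin 2) (Fin 2) ℂ) ⟨(⟨x, ν, μ, h⟩ : Plaq P j).src.shift (⟨x, ν, μ, h⟩ : Plaq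 P j).ν, (⟨x, ν, μ, h⟩ : Plaq P j).μ⟩))) + ((-((Complex.I * (η : ℂ)) • A ⟨(⟨x, ν, μ, h⟩ : Plaq P j).src, (⟨x, ν, μ, h⟩ : Plaq P j).ν⟩)) + t • (-((Complex.I * (η : ℂ)) • (Pi.single (⟨x, μ⟩ : PBond P j) E : PBond P j → Matrix (Fin 2) (Fin 2) ℂ) ⟨(⟨x, ν, μ, h⟩ : Plaq P j).src, (⟨x, ν, μ, h⟩ : Plaq P j).ν⟩)))) ^ 2))) =
      fun t : ℂ => (1 - (2 : ℂ)⁻¹ * Matrix.trace (exp ((Complex.I * (η : ℂ)) • A ⟨x, ν⟩) * exp ((Complex.I * (η : ℂ)) • A ⟨x.shift ν, μ⟩) * exp (-((Complex.I * (η : ℂ)) • A ⟨x.shift μ, ν⟩)) * exp ((-((Complex.I * (η : ℂ)) • A ⟨x, μ⟩)) + t • (-((Complex.I * (η : ℂ)) • E)))) + (2 : ℂ)⁻¹ * Matrix.trace (((Complex.I * (η : ℂ)) • A ⟨x, ν⟩) + ((Complex.I * (η : ℂ)) • A ⟨x.shift ν, μ⟩) + (-((Complex.I * (η : ℂ)) •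 A ⟨x.shift μ, ν⟩)) + ((-((Complex.I * (η : ℂ)) • A ⟨x, μ⟩)) + t • (-((Complex.I * (η : ℂ)) • E)))) + (4 : ℂ)⁻¹ * Matrix.trace ((((Complex.I * (η : ℂ)) • A ⟨x, ν⟩) + ((Complex.I * (η : ℂ)) • A ⟨x.shift ν, μ⟩) + (-((Complex.I * (η : ℂ)) • A ⟨x.shift μ, ν⟩)) + ((-((Complex.I * (η : ℂ)) • A ⟨x, μ⟩)) + t • (-((Complex.I * (η : ℂ)) • E)))) ^ 2)) := by
    funext t
    simp only [Pi.single_eq_same, Pi.single_apply, if_neg n1, if_neg n2, if_neg n3, smul_zero, neg_zero, add_zero, smul_neg]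
  rw [F2, F4]
  have nc : ∀ X : Matrix (Fin 2) (Fin 2) ℂ, ‖(Complex.I * (η : ℂ)) • X‖ = η * ‖X‖ := norm_cI_smul hη
  have hH : ‖((Complex.I * (η : ℂ)) • E)‖ ≤ η := by rw [nc]; exact (mul_le_mul_of_nonneg_left hE hη.le).trans (by rw [mul_one])
  have hm0 : 0 ≤ η * s := by positivity
  have bY : ∀ b' : PBond P j, distSite (Mk P j) b'.src x ≤ 2 → ‖(Complex.I * (η : ℂ)) • A b'‖ ≤ η * s := fun b' hd => by
    rw [nc]; exact mul_le_mul_of_nonneg_left (hA b' hd) hη.le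
  have bYn : ∀ b' : PBond P j, distSite (Mk P j) b'.src x ≤ 2 → ‖-((Complex.I * (η : ℂ)) • A b')‖ ≤ η * s := fun b' hd => by
    rw [norm_neg]; exact bY b' hd
  have dd : ∀ b₁ b₂ : PBond P j, ‖A b₁ - A b₂‖ ≤ η * g →
      ‖(Complex.I * (η : ℂ)) • A b₁ - (Complex.I * (η : ℂ)) • A b₂‖ ≤ η * (η * g) := fun b₁ b₂ hb => by
    rw [← smul_sub, nc]; exact mul_le_mul_of_nonneg_left hb hη.le
  have ddn : ∀ b₁ b₂ : PBond P j, ‖A b₁ - A b₂‖ ≤ η * g →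
      ‖-((Complex.I * (η : ℂ)) • A b₁) - -((Complex.I * (η : ℂ)) • A b₂)‖ ≤ η * (η * g) := fun b₁ b₂ hb => by
    rw [neg_sub_neg, ← smul_sub, nc, norm_sub_rev]; exact mul_le_mul_of_nonneg_left hb hη.le
  have dpn : ∀ b₁ b₂ : PBond P j, ‖A b₁ - A b₂‖ ≤ η * g →
      ‖(Complex.I * (η : ℂ)) • A b₁ + -((Complex.I * (η : ℂ)) • A b₂)‖ ≤ η * (η * g) := fun b₁ b₂ hb => by
    rw [← sub_eq_add_neg, ← smul_sub, nc]; exact mul_le_mul_of_nonneg_left hb hη.le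
  have dnp : ∀ b₁ b₂ : PBond P j, ‖A b₂ - A b₁‖ ≤ η * g →
      ‖-((Complex.I * (η : ℂ)) • A b₁) + (Complex.I * (η : ℂ)) • A b₂‖ ≤ η * (η * g) := fun b₁ b₂ hb => by
    rw [add_comm, ← sub_eq_add_neg, ← smul_sub, nc]; exact mul_le_mul_of_nonneg_left hb hη.le
  have e2 : ((x.unshift ν).shift μ).shift ν = x.shift μ := by rw [unshift_shift_comm, Site.shift_unshift]
  -- slotwise: Y = slots of p_{νμ}(x), Z = slots of p_{νμ}(x − e_ν)
  have d1 := dd ⟨x, ν⟩ ⟨x.unshift ν, ν⟩ (by simpa only [Site.shift_unshift] using hD' (x.unshift ν) ν ν (du ν))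
  have d2 := dd ⟨x.shift ν, μ⟩ ⟨x, μ⟩ (hD' x μ ν d0)
  have d3 := ddn ⟨x.shift μ, ν⟩ ⟨(x.unshift ν).shift μ, ν⟩ (by simpa only [e2] using hD' ((x.unshift ν).shift μ) ν ν (dus ν μ))
  have d4 := ddn ⟨x, μ⟩ ⟨x.unshift ν, μ⟩ (by simpa only [Site.shift_unshift] using hD' (x.unshift ν) μ ν (du ν))
  have hS := dpn ⟨x, μ⟩ ⟨x.unshift ν, μ⟩ (by simpa only [Site.shift_unshift] using hD' (x.unshift ν) μ ν (du ν))
  have hT := dnp ⟨(x.unshift ν).shift μ, ν⟩ ⟨x.unshift ν, ν⟩ (by rw [norm_sub_rev]; exact hD' (x.unshift ν) ν μ (du ν))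
  have hm1 : η * s + s * ‖((Complex.I * (η : ℂ)) • E)‖ ≤ 1 := by nlinarith [norm_nonneg ((Complex.I * (η : ℂ)) • E)]
  have dsμ := dsh μ
  have dsν := dsh ν
  have duν := du ν
  have dusνμ := dus ν μ
  have key := norm_deriv_pair42_le ((Complex.I * (η : ℂ)) • A ⟨x, ν⟩) ((Complex.I * (η : ℂ)) • A ⟨x.shift ν, μ⟩) (-((Complex.I * (η : ℂ)) • A ⟨x.shift μ, ν⟩)) (-((Complex.I * (η : ℂ)) • A ⟨x, μ⟩)) ((Complex.I * (η : ℂ)) • A ⟨x.unshift ν, ν⟩) ((Complex.I * (η : ℂ)) • A ⟨x, μ⟩) (-((Complex.I * (η : ℂ)) • A ⟨(x.unshift ν).shift μ, ν⟩)) (-((Complex.I * (η : ℂ)) • A ⟨x.unshift ν, μ⟩)) ((Complex.I * (η : ℂ)) • E) hm0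
    (bY _ (by assumption)) (bY _ (by assumption)) (bYn _ (by assumption)) (bYn _ (by assumption)) (bY _ (by assumption)) (bY _ (by assumption)) (bYn _ (by assumption)) (bYn _ (by assumption)) d1 d2 d3 d4 hS hT hs hm1
  exact key.trans (pair_arith_local hη hs hg (norm_nonneg _) hH)


end Pairs

/-! ## §3 The directional derivative and the gradient at one bond, local sizes -/

section Local

variable {η : ℝ} [DecidableEq (PBond P j)]

/-- **`|D𝒱_η(A)[1_bE]| ≤ 2d·η⁴(20sg + ηg² + 1408s³)`** under the LOCAL sizes at `b₋` (sup `s`, `η⁻¹`-gradient `g`, within sup-distance `2`), `‖E‖ ≤ 1`, `0 < s`, `ηs ≤ ½`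
(the pairing of §2 summed over the `d` transverse directions, as in `norm_fderiv_single_le`). [cite: Balaban1985Variational, (90)-(98) pp.291-293] -/
theorem norm_fderiv_single_le_local (hη : 0 < η) {s g : ℝ} (hs : 0 < s) (hg : 0 ≤ g) (hηs : η * s ≤ 1 / 2)
    (A : PBond P j → Matrix (Fin 2) (Fin 2) ℂ) (b : PBond P j)
    (hA : ∀ b' : PBond P j, distSite (Mk P j) b'.src b.src ≤ 2 → ‖A b'‖ ≤ s)
    (hD : ∀ (s' : Site P j) (μ ν : Fin P.d), distSite (Mk P j) s' b.src ≤ 2 → η⁻¹ * ‖A ⟨s'.shift ν, μ⟩ - A ⟨s', μ⟩‖ ≤ g)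
    (E : Matrix (Fin 2) (Fin 2) ℂ) (hE : ‖E‖ ≤ 1) :
    ‖fderiv ℂ (fun A : PBond P j → Matrix (Fin 2) (Fin 2) ℂ => (∑ p : Plaq P j, (1 - (2 : ℂ)⁻¹ * Matrix.trace (exp ((Complex.I * (η : ℂ)) • A ⟨p.src, p.μ⟩) * exp ((Complex.I * (η : ℂ)) • A ⟨p.src.shift p.μ, p.ν⟩) * exp (-((Complex.I * (η : ℂ)) • A ⟨p.src.shift p.ν, p.μ⟩)) * exp (-((Complex.I * (η : ℂ)) • A ⟨p.src, p.ν⟩))) + (2 : ℂ)⁻¹ * Matrix.trace (((Complex.I * (η : ℂ)) • A ⟨p.src, p.μ⟩) + ((Complex.I * (η : ℂ)) • A ⟨p.src.shift p.μ, p.ν⟩) + (-((Complex.I * (η : ℂ)) • A ⟨p.src.shift p.ν, p.μ⟩)) + (-((Complex.I * (η : ℂ)) • A ⟨p.src, p.ν⟩))) + (4 : ℂ)⁻¹ * Matrix.trace ((((Complex.I * (η : ℂ)) • A ⟨p.src, p.μ⟩) + ((Complex.I * (η : ℂ)) • A ⟨p.src.shift p.μ, p.ν⟩) + (-((Complex.I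 * (η : ℂ)) • A ⟨p.src.shift p.ν, p.μ⟩)) + (-((Complex.I * (η : ℂ)) • A ⟨p.src, p.ν⟩))) ^ 2)))) A (Pi.single b E)‖ ≤ 2 * P.d * (η ^ 4 * (20 * s * g + η * g ^ 2 + 1408 * s ^ 3)) := by
  rw [fderiv_V_eq_sum, sum_deriv_line_single_eq_pairs]
  refine (norm_sum_le _ _).trans ?_
  have h0 : (0 : ℝ) ≤ η ^ 4 * (20 * s * g + η * g ^ 2 + 1408 * s ^ 3) := by positivity
  refine (sum_le_sum (g := fun _ => 2 * (η ^ 4 * (20 * s * g + η * g ^ 2 + 1408 * s ^ 3))) fun ν _ => ?_).trans ?_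
  · refine (norm_add_le _ _).trans ?_
    refine (add_le_add (?_ : _ ≤ η ^ 4 * (20 * s * g + η * g ^ 2 + 1408 * s ^ 3)) (?_ : _ ≤ η ^ 4 * (20 * s * g + η * g ^ 2 + 1408 * s ^ 3))).trans (by linarith)
    · split_ifs with h
      · exact norm_pair13_le_local hη hs hg hηs A b.src hA hD E hE b rfl ν h
      · rwa [norm_zero]
    · split_ifs with h
      · exact norm_pair42_le_local hη hs hg hηs A b.src hA hD E hE b rfl ν h
      · rwa [norm_zero]
  · rw [sum_const, card_univ, Fintype.card_fin, nsmul_eq_mul]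
    exact le_of_eq (by ring)

/-- **THE LOCAL TWO-PARAMETER (98) FOR THE PURE-ACTION GRADIENT**: for ANY `W` representing `D𝒱_η` in print's pairing (`D𝒱_η(A)[δ] = η⁴Σ_b tr(W(A)(b)δ(b))` for all
`A, δ` — the (grad) clause of `exists_gradient_prop4_bg1`, which determines `W`), and the local sizes `s` (sup), `g` (`η⁻¹`-gradient) of `A` on the bonds from sites within
sup-distance `2` of `b₋`, `0 < s`, `ηs ≤ ½`: `‖W(A)(b)‖ ≤ 4d·(20sg + ηg² + 1408s³)` — no global smallness of `A`.  [cite: Balaban1985Variational, (97)-(98) pp.292-293, (90) p.291] -/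
theorem norm_gradient_le_local (hη : 0 < η) (W : (PBond P j → Matrix (Fin 2) (Fin 2) ℂ) → (PBond P j → Matrix (Fin 2) (Fin 2) ℂ))
    (hgrad : ∀ A δ : PBond P j → Matrix (Fin 2) (Fin 2) ℂ, fderiv ℂ (fun A : PBond P j → Matrix (Fin 2) (Fin 2) ℂ => (∑ p : Plaq P j, (1 - (2 : ℂ)⁻¹ * Matrix.trace (exp ((Complex.I * (η : ℂ)) • A ⟨p.src, p.μ⟩) * exp ((Complex.I * (η : ℂ)) • A ⟨p.src.shift p.μ, p.ν⟩) * exp (-((Complex.I * (η : ℂ)) • A ⟨p.src.shift p.ν, p.μ⟩)) * exp (-((Complex.I * (η : ℂ)) • A ⟨p.src, p.ν⟩))) + (2 : ℂ)⁻¹ * Matrix.trace (((Complex.I * (η : ℂ)) • A ⟨p.src, p.μ⟩) + ((Complex.I * (η : ℂ)) • A ⟨p.src.shift p.μ, p.ν⟩) + (-((Complex.I * (η : ℂ)) • A ⟨p.src.shift p.ν, p.μ⟩)) + (-((Complex.I * (η : ℂ)) • A ⟨p.src, p.ν⟩))) + (4 : ℂ)⁻¹ * Matrix.trace ((((Complex.I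 * (η : ℂ)) • A ⟨p.src, p.μ⟩) + ((Complex.I * (η : ℂ)) • A ⟨p.src.shift p.μ, p.ν⟩) + (-((Complex.I * (η : ℂ)) • A ⟨p.src.shift p.ν, p.μ⟩)) + (-((Complex.I * (η : ℂ)) • A ⟨p.src, p.ν⟩))) ^ 2)))) A δ = (η : ℂ) ^ 4 * ∑ b : PBond P j, Matrix.trace (W A b * δ b))
    {s g : ℝ} (hs : 0 < s) (hg : 0 ≤ g) (hηs : η * s ≤ 1 / 2) (A : PBond P j → Matrix (Fin 2) (Fin 2) ℂ) (b : PBond P j)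
    (hA : ∀ b' : PBond P j, distSite (Mk P j) b'.src b.src ≤ 2 → ‖A b'‖ ≤ s)
    (hD : ∀ (s' : Site P j) (μ ν : Fin P.d), distSite (Mk P j) s' b.src ≤ 2 → η⁻¹ * ‖A ⟨s'.shift ν, μ⟩ - A ⟨s', μ⟩‖ ≤ g) :
    ‖W A b‖ ≤ 4 * P.d * (20 * s * g + η * g ^ 2 + 1408 * s ^ 3) := by
  set Θ : ℝ := 20 * s * g + η * g ^ 2 + 1408 * s ^ 3 with hΘ
  have hΘ0 : 0 ≤ Θ := by positivity
  have hη4 : ((η : ℂ) ^ 4) ≠ 0 := pow_ne_zero _ (Complex.ofReal_ne_zero.mpr hη.ne')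
  have hη4n : ‖((η : ℂ) ^ 4)‖ = η ^ 4 := by rw [norm_pow, Complex.norm_real, Real.norm_eq_abs, abs_of_pos hη]
  -- the entries of `W A b` are `η⁻⁴·D𝒱_η(A)[1_b E_{ik}]`
  have hentry : ∀ i k : Fin 2, (η : ℂ) ^ 4 * W A b k i = fderiv ℂ (fun A : PBond P j → Matrix (Fin 2) (Fin 2) ℂ => (∑ p : Plaq P j, (1 - (2 : ℂ)⁻¹ * Matrix.trace (exp ((Complex.I * (η : ℂ)) • A ⟨p.src, p.μ⟩) * exp ((Complex.I * (η : ℂ)) • A ⟨p.src.shift p.μ, p.ν⟩) * exp (-((Complex.I * (η : ℂ)) • A ⟨p.src.shift p.ν, p.μ⟩)) * exp (-((Complex.I * (η : ℂ)) • A ⟨p.src, p.ν⟩))) + (2 : ℂ)⁻¹ * Matrix.trace (((Complex.I * (η : ℂ)) • A ⟨p.src, p.μ⟩) + ((Complex.I * (η : ℂ)) • A ⟨p.src.shift p.μ, p.ν⟩) + (-((Complex.I * (η : ℂ)) • A ⟨p.src.shift p.ν, p.μ⟩)) + (-((Complex.I * (η : ℂ)) • A ⟨p.src, p.ν⟩)))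 + (4 : ℂ)⁻¹ * Matrix.trace ((((Complex.I * (η : ℂ)) • A ⟨p.src, p.μ⟩) + ((Complex.I * (η : ℂ)) • A ⟨p.src.shift p.μ, p.ν⟩) + (-((Complex.I * (η : ℂ)) • A ⟨p.src.shift p.ν, p.μ⟩)) + (-((Complex.I * (η : ℂ)) • A ⟨p.src, p.ν⟩))) ^ 2)))) A (Pi.single b (Matrix.single i k (1 : ℂ))) := by
    intro i k
    rw [hgrad, Finset.sum_eq_single b]
    · rw [Pi.single_eq_same, Matrix.trace_mul_comm, trace_single_mul']
    · intro b' _ hb'; rw [Pi.single_apply, if_neg hb', mul_zero, Matrix.trace_zero]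
    · intro hb; exact absurd (Finset.mem_univ b) hb
  have hbound : ∀ i k : Fin 2, ‖W A b k i‖ ≤ 2 * P.d * Θ := by
    intro i k
    have h1 := norm_fderiv_single_le_local hη hs hg hηs A b hA hD (Matrix.single i k (1 : ℂ)) (norm_single_le_one k i)
    rw [← hentry i k, norm_mul, hη4n] at h1
    have hη4pos : 0 < η ^ 4 := by positivity
    have : η ^ 4 * ‖W A b k i‖ ≤ η ^ 4 * (2 * P.d * Θ) := by rw [hΘ]; linarith
    exact le_of_mul_le_mul_left this hη4pos
  -- operator norm from the entries
  have hsq := MatrixNorms.opNorm_sq_le_sum_norm_sq (W A b)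
  have hsum : ∑ a : Fin 2, ∑ c : Fin 2, ‖W A b a c‖ ^ 2 ≤ 4 * (2 * P.d * Θ) ^ 2 := by
    have hle : ∀ a c : Fin 2, ‖W A b a c‖ ^ 2 ≤ (2 * P.d * Θ) ^ 2 := fun a c =>
      pow_le_pow_left₀ (norm_nonneg _) (hbound c a) 2
    calc ∑ a : Fin 2, ∑ c : Fin 2, ‖W A b a c‖ ^ 2 ≤ ∑ a : Fin 2, ∑ c : Fin 2, (2 * P.d * Θ) ^ 2 := sum_le_sum fun a _ => sum_le_sum fun c _ => hle a c
      _ = 4 * (2 * P.d * Θ) ^ 2 := by simp only [sum_const, card_univ, Fintype.card_fin]; ring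
  have hd0 : (0 : ℝ) ≤ 2 * P.d * Θ := by positivity
  have h2 : ‖W A b‖ ^ 2 ≤ (2 * (2 * P.d * Θ)) ^ 2 := by nlinarith
  have h3 : ‖W A b‖ ≤ 2 * (2 * P.d * Θ) := (pow_le_pow_iff_left₀ (norm_nonneg _) (by positivity) two_ne_zero).1 h2
  linarith

end Local


end Summit.QuantumFields.YangMills.Theorems.FlatProp4Bg1

end
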